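import Literature.Analysis.FluidPDE.OnsagerBDSVStressSplit
import Literature.Analysis.FluidPDE.OnsagerBDSVOscillationSplit
import Literature.Analysis.FluidPDE.OnsagerBDSVOscillationCorrectorProof
import Literature.Analysis.FluidPDE.OnsagerBDSVOscillationPrincipalDiv
import Literature.Analysis.FluidPDE.OnsagerBDSVOscillationSplitProofs
import Literature.Analysis.FluidPDE.OnsagerBDSVOscillationPrincipalProofs
import Literature.Analysis.FluidPDE.OnsagerBDSVNashErrorProof
import Literature.Analysis.FluidPDE.DeRosaPertEnergy
import Literature.Analysis.FluidPDE.DeRosaPerturbation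
import HarnessLib

/-!
# De Rosa's perturbation stage: the Nash and oscillation errors of Prop. 5.13 under the core
# hypotheses — port of the BDSV proofs of Prop. 6.1 (Nash and oscillation terms)

L. De Rosa, *Infinitely many Leray–Hopf solutions for the fractional Navier–Stokes equations*,
Comm. PDE 44 (2019) 335–365 = arXiv:1801.10235, §5.5 Prop. 5.13, the Euler part of the new
stress: "`‖R̊^E_{q+1}‖₀ ≲ δ_{q+1}^{1/2}δ_q^{1/2}λ_q/λ_{q+1}^{1-4α}` … We are not going to give the proof
of the last estimate because, as already explained, it can be found in [BDLSV2017]" =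
Buckmaster–De Lellis–Székelyhidi–Vicol, CPAM 72 (2019), Prop. 6.1 and §6.1: `R̊^E_{q+1}` is the
sum of the Nash error `ℛ(w·∇v̄_q)`, the transport error `ℛ(∂ₜw + v̄_q·∇w)` and the oscillation
error `ℛ div(w ⊗ w - R̄_q)`, each bounded through the stationary-phase estimate Prop. C.2
(= De Rosa Prop. 8.2, proved in the tree: `BDSV.antidivergencePhaseBound_holds`). This file re-runs
VERBATIM under `DeRosa.CoreHypotheses` (namespace `DeRosa`, same names as the BDSV twins) the
tree's BDSV proofs of the NASH and OSCILLATION errors (`OnsagerBDSVStressSplit` — the two facts;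
`OnsagerBDSVOscillationSplit`, `OnsagerBDSVOscillationCorrectorProof`,
`OnsagerBDSVOscillationPrincipalDiv`, `OnsagerBDSVOscillationSplitProofs`,
`OnsagerBDSVOscillationPrincipalProofs`, `OnsagerBDSVNashErrorProof`), continuing
`DeRosaPertDeformation/Transport/Corrector/Increment/Energy.lean`. (The transport error, whose BDSV
twin is not yet discharged in the tree, and the assembly of `R̊^E` are left to a sequel.)

* `DeRosa.nashErrorEstimate` (§6.1, Nash error, with `CoreHypotheses`) PROVED:
  `nashErrorEstimate_holds`, with the bounds on the potential `Z` and its derivatives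
  (`PerturbationData.norm_potential_le`, `norm_partialDeriv_potential_le`,
  `potentialBound_stageFact`);
* `DeRosa.oscillationPrincipalEstimate`, `DeRosa.oscillationCorrectorEstimate`,
  `DeRosa.oscillationErrorEstimate` (§6.1, oscillation error and its two parts) PROVED:
  `oscillationPrincipalEstimate_holds`, `oscillationCorrectorEstimate_holds`,
  `oscillationErrorEstimate_holds` (through `oscillationErrorEstimate_of_parts`).

## References

* L. De Rosa, Comm. PDE 44 (2019) 335–365 = arXiv:1801.10235, §5.5 Prop. 5.13 (the term R̊^E),
  §8 Prop. 8.2. [`Derosa2018`]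
* T. Buckmaster, C. De Lellis, L. Székelyhidi Jr., V. Vicol, CPAM 72 (2019) 229–274 =
  arXiv:1701.08678, Prop. 6.1, §6.1 (Nash and oscillation errors), App. C Prop. C.2.
  [`BuckmasterEtAl2018`]
-/

open MeasureTheory Set
open scoped NNReal ENNReal ContDiff Matrix Matrix.Norms.Elementwise
open MeasureTheory Set Function
open scoped NNReal ENNReal ContDiff
open MeasureTheory Set Filter

noncomputable section

namespace Literature.Analysis.FluidPDE

/-! ## Port of `OnsagerBDSVStressSplit` -/

namespace DeRosa

open BDSV

open FunctionSpaces FunctionSpaces.Torus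

/-- The flat three-torus `T³ = (ℝ/ℤ)³`, local notation. -/
local notation "𝕋³" => UnitAddTorus (Fin 3)

/-- Euclidean `ℝ³`, local notation. -/
local notation "ℝ³" => EuclideanSpace ℝ (Fin 3)

section Facts

/-- **The Nash error estimate** (BDSV §6.1.1, concluding display, arXiv (6.5): "Summing over the
frequencies and using that `Σ_{k ∈ ℤ³∖{0}} |k|^{-6} < ∞`, we achieve
`ℛ(w_{q+1}·∇v̄_q) ≲ δ_{q+1}^{1/2} δ_q^{1/2} λ_q / λ_{q+1}^{1-α}`", the norm being the spatial `C^α`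
norm of the per-mode bounds arXiv (6.2)–(6.3), uniformly in `t`; proof: Prop. C.2 applied to each
mode `(∇Φ_i⁻¹ b_{i,k} + c_{i,k}) e^{iλ_{q+1}k·Φ_i} · ∇v̄_q` with Props. 5.7, 5.9, the choice of `N`
for `α` small (§6.1.1) and arXiv (6.4) `ℓ λ_{q+1} ≥ 1`, for `a` large). Transcription: the prefix
of `BDSV.stressEstimate`; `‖·‖_α` on `[0,T]` by `BDSV.HolderSupLE … 0 α`; the Nash term is
`BDSV.nashSource`; the power of `λ_{q+1}` is the `λ_{q+1}^{-(1-4α)}` of (6.1), implied by the printed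
`λ_{q+1}^{-(1-α)}` (module docstring, "Design choices"). [cite: BuckmasterEtAl2018, §6.1.1 (arXiv (6.5)) with Prop. 6.1 (6.1)] -/
def nashErrorEstimate : Prop :=
  ∀ (𝔚 : MikadoDatum mikadoRadius) (c₀ : ℝ), 0 < c₀ → ∀ Cη : ℕ → ℕ → ℝ,
    ∀ β : ℝ, 0 < β → β < 1 / 3 → ∀ b : ℝ, 1 < b → b < (1 - β) / (2 * β) →
      ∃ α₀ : ℝ, 0 < α₀ ∧ ∀ α : ℝ, 0 < α → α < α₀ → ∃ Nbar : ℕ, ∀ Cin C₀ : ℝ,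
        ∃ C a₀ : ℝ, 1 < a₀ ∧ ∀ a : ℝ, a₀ ≤ a → ∀ S : Setting,
          CoreHypotheses ⟨β, α, a, b⟩ S Nbar Cin C₀ →
            ∀ 𝒟 : PerturbationData ⟨β, α, a, b⟩ S c₀ Cη,
              HolderSupLE S.T
                (fun t => Torus.antidivergence (nashSource ⟨β, α, a, b⟩ S 𝔚 𝒟.cut.η 𝒟.D t))
                0 (Real.toNNReal α)
                (C * (Real.sqrt (amp β a b (S.q + 1)) * Real.sqrt (amp β a b S.q) *
                  freq a b S.q * freq a b (S.q + 1) ^ (-1 + 4 * α)))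

/-- **The oscillation error estimate** (BDSV §6.1.3, concluding display, arXiv (6.12): "Clearly,
(6.9) and (6.11) give
`‖ℛ div(-R̄_q + w_{q+1} ⊗ w_{q+1})‖_α ≲ δ_{q+1}^{1/2} δ_q^{1/2} λ_q / λ_{q+1}^{1-α}`"; proof: the
split `𝒪₁ + 𝒪₂`, `𝒪₂` by arXiv (6.9) and Cor. 5.8, `𝒪₁` by the identity arXiv (6.10)
`w_{o,i} ⊗ w_{o,i} = R_{q,i} + Σ_k ρ_{q,i} ∇Φ_i⁻¹ C_k(R̃_{q,i}) ∇Φ_i⁻ᵀ e^{iλ_{q+1}k·Φ_i}`, `C_k k = 0`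
(arXiv (5.7)), and Prop. C.2 (arXiv (6.11)), for `N` large and `a ≫ 1`; both (6.9) and (6.11)
pass from `δ_{q+1} ℓ^{-1} λ_{q+1}^{-(1-α)} = δ_{q+1}^{1/2} δ_q^{1/2} λ_q^{1+3α/2} λ_{q+1}^{-(1-α)}` to the
displayed right-hand side, i.e. absorb `λ_q^{3α/2} ≤ λ_{q+1}^{3α/2}`). Transcription as in
`BDSV.nashErrorEstimate`, with the power `λ_{q+1}^{-(1-4α)}` of (6.1) (implied by the printed
`λ_{q+1}^{-(1-α)}`, and by the derived `λ_{q+1}^{-(1-5α/2)}`); the oscillation term is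
`BDSV.oscillationSource`. [cite: BuckmasterEtAl2018, §6.1.3 (arXiv (6.12)) with Prop. 6.1 (6.1)] -/
def oscillationErrorEstimate : Prop :=
  ∀ (𝔚 : MikadoDatum mikadoRadius) (c₀ : ℝ), 0 < c₀ → ∀ Cη : ℕ → ℕ → ℝ,
    ∀ β : ℝ, 0 < β → β < 1 / 3 → ∀ b : ℝ, 1 < b → b < (1 - β) / (2 * β) →
      ∃ α₀ : ℝ, 0 < α₀ ∧ ∀ α : ℝ, 0 < α → α < α₀ → ∃ Nbar : ℕ, ∀ Cin C₀ : ℝ,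
        ∃ C a₀ : ℝ, 1 < a₀ ∧ ∀ a : ℝ, a₀ ≤ a → ∀ S : Setting,
          CoreHypotheses ⟨β, α, a, b⟩ S Nbar Cin C₀ →
            ∀ 𝒟 : PerturbationData ⟨β, α, a, b⟩ S c₀ Cη,
              HolderSupLE S.T
                (fun t => Torus.antidivergence (oscillationSource ⟨β, α, a, b⟩ S 𝔚 𝒟.cut.η 𝒟.D t))
                0 (Real.toNNReal α)
                (C * (Real.sqrt (amp β a b (S.q + 1)) * Real.sqrt (amp β a b S.q) *
                  freq a b S.q * freq a b (S.q + 1) ^ (-1 + 4 * α)))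

end Facts

end DeRosa

/-! ## Port of `OnsagerBDSVOscillationSplit` -/

namespace DeRosa

open BDSV

open FunctionSpaces FunctionSpaces.Torus

/-- The flat three-torus `T³ = (ℝ/ℤ)³`, local notation. -/
local notation "𝕋³" => UnitAddTorus (Fin 3)

/-- Euclidean `ℝ³`, local notation. -/
local notation "ℝ³" => EuclideanSpace ℝ (Fin 3)

section Facts

/-- `BDSV.oscillationErrorEstimate` is the stage fact (`BDSV.StageFact`) with body "the `C^{0,α}`
norms of `ℛ div(w ⊗ w - R̄_q)` on `[0,T]` are at most `C` times the scale of (6.1)"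
(definitionally). [cite: BuckmasterEtAl2018, §6.1.3 (arXiv (6.12))] -/
theorem oscillationErrorEstimate_iff_stageFact :
    oscillationErrorEstimate ↔ StageFact fun 𝔚 P C S _ _ 𝒟 =>
      HolderSupLE S.T (fun t => Torus.antidivergence (oscillationSource P S 𝔚 𝒟.cut.η 𝒟.D t))
        0 (Real.toNNReal P.α)
        (C * (Real.sqrt (amp P.β P.a P.b (S.q + 1)) * Real.sqrt (amp P.β P.a P.b S.q) *
          freq P.a P.b S.q * freq P.a P.b (S.q + 1) ^ (-1 + 4 * P.α))) :=
  Iff.rfl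

/-- **The principal oscillation term `𝒪₁`** (BDSV §6.1.3, arXiv (6.11): with
`𝒪₁ = ℛ div(-R̄_q + Σ_i w_{o,i} ⊗ w_{o,i})` (disjoint supports of the `η_i`), the expansion
arXiv (6.10) `w_{o,i} ⊗ w_{o,i} = R_{q,i} + Σ_{k≠0} ρ_{q,i} ∇Φ_i⁻¹ C_k(R̃_{q,i}) ∇Φ_i⁻ᵀ e^{iλ_{q+1}k·Φ_i}`
and `∇Φ_i⁻¹ C_k ∇Φ_i⁻ᵀ ∇Φ_iᵀ k = 0`, "by Proposition C.2,
`‖𝒪₁‖_α ≲ Σ_i Σ_{k≠0} ‖div(ρ_{q,i}∇Φ_i⁻¹C_k(R̃_{q,i})∇Φ_i⁻ᵀ)‖₀/λ_{q+1}^{1-α} + [terms of order N]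
≲ Σ_i Σ_{k≠0} δ_{q+1}/(ℓλ_{q+1}^{1-α}|k|⁶) ≲ δ_{q+1}^{1/2}δ_q^{1/2}λ_q/λ_{q+1}^{1-α}`", with "a large
choice of `N`"). Transcription: along `BDSV.StageFact`, for `𝒪₁ = ℛ(BDSV.oscPrincipalSource)` built
on `w_o = BDSV.principalPart`, the `C^{0,α}` norms on `[0,T]` (`BDSV.HolderSupLE … 0 α`) are at
most `C δ_{q+1}^{1/2} δ_q^{1/2} λ_q λ_{q+1}^{-(1-4α)}` — the exponent of (6.1), implied by the printed
display up to the factor `λ_q^{3α/2} ≤ λ_{q+1}^{3α/2}` it tacitly absorbs (module docstring).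
[cite: BuckmasterEtAl2018, §6.1.3 (arXiv (6.11)) with Prop. 6.1 (6.1)] -/
def oscillationPrincipalEstimate : Prop :=
  StageFact fun 𝔚 P C S _ _ 𝒟 =>
    HolderSupLE S.T (fun t => Torus.antidivergence (oscPrincipalSource P S 𝔚 𝒟.cut.η 𝒟.D t))
      0 (Real.toNNReal P.α)
      (C * (Real.sqrt (amp P.β P.a P.b (S.q + 1)) * Real.sqrt (amp P.β P.a P.b S.q) *
        freq P.a P.b S.q * freq P.a P.b (S.q + 1) ^ (-1 + 4 * P.α)))

/-- **The corrector oscillation term `𝒪₂`** (BDSV §6.1.3, arXiv (6.9): "`‖𝒪₂‖_α ≲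
‖w_o ⊗ w_c + w_c ⊗ w_o + w_c ⊗ w_c‖_α ≲ ‖w_o‖₀‖w_c‖_α + ‖w_o‖_α‖w_c‖₀ + ‖w_c‖_α² ≲ δ_{q+1}/(ℓλ_{q+1}^{1-α})
≲ δ_{q+1}^{1/2}δ_q^{1/2}λ_q/λ_{q+1}^{1-α}`", by the Calderón–Zygmund bound for `ℛ div` (Prop. C.1)
and the bounds of Cor. 5.8 on `w_o`, `w_c`). Transcription as in `BDSV.oscillationPrincipalEstimate`,
for `𝒪₂ = ℛ(BDSV.oscCorrectorSource)` built on `w_o = BDSV.principalPart`, `w_c = BDSV.correctorPart`.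
[cite: BuckmasterEtAl2018, §6.1.3 (arXiv (6.9)) with Prop. 6.1 (6.1)] -/
def oscillationCorrectorEstimate : Prop :=
  StageFact fun 𝔚 P C S _ _ 𝒟 =>
    HolderSupLE S.T (fun t => Torus.antidivergence (oscCorrectorSource P S 𝔚 𝒟.cut.η 𝒟.D t))
      0 (Real.toNNReal P.α)
      (C * (Real.sqrt (amp P.β P.a P.b (S.q + 1)) * Real.sqrt (amp P.β P.a P.b S.q) *
        freq P.a P.b S.q * freq P.a P.b (S.q + 1) ^ (-1 + 4 * P.α)))

end Facts

section Assembly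

/-- **Assembly of the oscillation error from its two parts** (BDSV §6.1.3: "Clearly, (6.9) and
(6.11) give (6.12)"): the estimates of `𝒪₁` and `𝒪₂` imply `BDSV.oscillationErrorEstimate`, with
the extremal thresholds of the two facts together with `α < βb(b-1)` and the threshold of
`BDSV.exists_threshold_amp_succ_succ` (making `ρ_q > 0`, so that the construction is smooth and
`ℛ div` splits), and the constant `max(C₁,0) + max(C₂,0)`. [cite: BuckmasterEtAl2018, §6.1.3 (arXiv (6.12))] -/
theorem oscillationErrorEstimate_of_parts (h₁ : oscillationPrincipalEstimate)
    (h₂ : oscillationCorrectorEstimate) : oscillationErrorEstimate := by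
  intro 𝔚 c₀ hc₀ Cη β hβ hβ' b hb hb'
  obtain ⟨α₁, hα₁, h₁⟩ := h₁ 𝔚 c₀ hc₀ Cη β hβ hβ' b hb hb'
  obtain ⟨α₂, hα₂, h₂⟩ := h₂ 𝔚 c₀ hc₀ Cη β hβ hβ' b hb hb'
  have hαρ : 0 < β * b * (b - 1) := mul_pos (mul_pos hβ (by linarith)) (by linarith)
  refine ⟨min (min α₁ α₂) (β * b * (b - 1)), lt_min (lt_min hα₁ hα₂) hαρ, ?_⟩
  intro α hα hαlt
  have hα12 : α < min α₁ α₂ := lt_of_lt_of_le hαlt (min_le_left _ _)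
  have hαρ' : α < 2 * β * b * (b - 1) := by
    have := lt_of_lt_of_le hαlt (min_le_right _ _)
    nlinarith
  obtain ⟨N₁, h₁⟩ := h₁ α hα (lt_of_lt_of_le hα12 (min_le_left _ _))
  obtain ⟨N₂, h₂⟩ := h₂ α hα (lt_of_lt_of_le hα12 (min_le_right _ _))
  refine ⟨max N₁ N₂, fun Cin C₀ => ?_⟩
  obtain ⟨C₁, a₁, ha₁, h₁⟩ := h₁ Cin C₀
  obtain ⟨C₂, a₂, ha₂, h₂⟩ := h₂ Cin C₀
  obtain ⟨aρ, haρ, hρ⟩ := exists_threshold_amp_succ_succ hb hαρ'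
  refine ⟨max C₁ 0 + max C₂ 0, max (max a₁ a₂) aρ, lt_max_of_lt_left (lt_max_of_lt_left ha₁), ?_⟩
  intro a ha S H 𝒟
  have ha12 : max a₁ a₂ ≤ a := le_trans (le_max_left _ _) ha
  have ha₁' : a₁ ≤ a := le_trans (le_max_left _ _) ha12
  have ha₂' : a₂ ≤ a := le_trans (le_max_right _ _) ha12
  have haρ' : aρ ≤ a := le_trans (le_max_right _ _) ha
  have ha1 : (1 : ℝ) ≤ a := le_trans ha₁.le ha₁'
  have e₁ := h₁ a ha₁' S (H.of_le (le_max_left _ _)) 𝒟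
  have e₂ := h₂ a ha₂' S (H.of_le (le_max_right _ _)) 𝒟
  have hsm : SmoothData ⟨β, α, a, b⟩ S 𝒟.cut.η 𝒟.D := H.smoothData ha1 (hρ a haρ' S.q) hc₀ 𝒟
  have hs := stressScale_nonneg (β := β) (α := α) (b := b) ha1 S.q
  have key := HolderSupLE.add e₁ e₂
    (fun t ht => Torus.isSmooth_antidivergence ((hsm.oscPrincipalSource 𝔚).isSmooth_slice ht))
    (fun t ht => Torus.isSmooth_antidivergence ((hsm.oscCorrectorSource 𝔚).isSmooth_slice ht))
  intro t ht
  beta_reduce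
  rw [hsm.antidivergence_oscillationSource_eq_add 𝔚 ht]
  refine (key t ht).trans (ENNReal.ofReal_le_ofReal ?_)
  rw [add_mul]
  exact add_le_add (max_mul_le_max_mul hs) (max_mul_le_max_mul hs)

end Assembly

end DeRosa

/-! ## Port of `OnsagerBDSVOscillationCorrectorProof` -/

namespace DeRosa

open BDSV

open FunctionSpaces FunctionSpaces.Torus

variable {β α a b : ℝ}

set_option maxHeartbeats 800000 in
/-- **Proof of the corrector estimate `𝒪₂`** (BDSV §6.1.3, arXiv (6.9)) from the Calderón–Zygmund
bound (Prop. C.1, `BDSV.holderCZBound`) and Cor. 5.8 (`BDSV.principalPartBound`,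
`BDSV.correctorPartBound`): along the common prefix, the `C^{0,α}` norms of
`𝒪₂ = ℛ div(w_o ⊗ w_c + w_c ⊗ w_o + w_c ⊗ w_c)` on `[0,T]` are at most
`C δ_{q+1}^{1/2} δ_q^{1/2} λ_q λ_{q+1}^{-(1-4α)}` (module docstring for the steps).
[cite: BuckmasterEtAl2018, §6.1.3 (arXiv (6.9))] -/
theorem oscillationCorrectorEstimate_of_bounds (hCZ : holderCZBound) (hP : principalPartBound)
    (hC : correctorPartBound) : oscillationCorrectorEstimate := by
  intro 𝔚 c₀ hc₀ Cη β hβ hβ' b hb hb'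
  obtain ⟨α₁, hα₁, hP⟩ := hP 𝔚 c₀ hc₀ Cη β hβ hβ' b hb hb'
  obtain ⟨α₂, hα₂, hC⟩ := hC 𝔚 c₀ hc₀ Cη β hβ hβ' b hb hb'
  have hαρ : 0 < β * b * (b - 1) := mul_pos (mul_pos hβ (by linarith)) (by linarith)
  have hα64 : 0 < (b - 1) * (1 - β) / 3 := div_pos (mul_pos (by linarith) (by linarith)) three_pos
  refine ⟨min (min α₁ α₂) (min (min (1 / 2) (β * b * (b - 1))) ((b - 1) * (1 - β) / 3)),
    lt_min (lt_min hα₁ hα₂) (lt_min (lt_min one_half_pos hαρ) hα64), ?_⟩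
  intro α hα hαlt
  have hα12 : α < min α₁ α₂ := lt_of_lt_of_le hαlt (min_le_left _ _)
  have hαr : α < min (min (1 / 2) (β * b * (b - 1))) ((b - 1) * (1 - β) / 3) :=
    lt_of_lt_of_le hαlt (min_le_right _ _)
  have hα1 : α < 1 := by
    have := lt_of_lt_of_le hαr ((min_le_left _ _).trans (min_le_left _ _)); linarith
  have hαρ' : α < 2 * β * b * (b - 1) := by
    have := lt_of_lt_of_le hαr ((min_le_left _ _).trans (min_le_right _ _)); nlinarith
  have hαb : 3 * α / 2 < (b - 1) * (1 - β) := by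
    have := lt_of_lt_of_le hαr (min_le_right _ _); nlinarith
  obtain ⟨N₁, hP⟩ := hP α hα (lt_of_lt_of_le hα12 (min_le_left _ _))
  obtain ⟨N₂, hC⟩ := hC α hα (lt_of_lt_of_le hα12 (min_le_right _ _))
  -- the Hölder exponent as an `ℝ≥0` and the Calderón–Zygmund constant
  set r : ℝ≥0 := ⟨α, hα.le⟩ with hr
  have hr0 : 0 < r := hα
  have hr1 : r < 1 := hα1
  have hrα : Real.toNNReal α = r := by
    rw [hr]; exact Real.toNNReal_of_nonneg hα.le
  clear_value r
  obtain ⟨CR, hR⟩ := holder_antidivergence_tensorDivergence_le hCZ hr0 hr1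
  refine ⟨max N₁ N₂, fun Cin C₀ => ?_⟩
  obtain ⟨C₁, a₁, ha₁, hP⟩ := hP Cin C₀
  obtain ⟨C₂, a₂, ha₂, hC⟩ := hC Cin C₀
  obtain ⟨aρ, haρ, hρ⟩ := exists_threshold_amp_succ_succ hb hαρ'
  obtain ⟨a₆, ha₆, h64⟩ := exists_threshold_mollScale_freq_succ hb.le hαb 1
  -- the constants
  set Ch : ℝ := max C₁ 0 + max C₂ 0 with hCh
  have hCh0 : 0 ≤ Ch := add_nonneg (le_max_right _ _) (le_max_right _ _)
  have hC₁ : C₁ ≤ Ch := (le_max_left _ _).trans (le_add_of_nonneg_right (le_max_right _ _))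
  have hC₂ : C₂ ≤ Ch := (le_max_left _ _).trans (le_add_of_nonneg_left (le_max_right _ _))
  set cK : ℝ := Real.sqrt 3 * 3 + 2 with hcK
  have hcK1 : 1 ≤ cK := by
    have := Real.sqrt_nonneg 3; rw [hcK]; nlinarith
  have hcK0 : 0 ≤ cK := zero_le_one.trans hcK1
  clear_value Ch cK
  refine ⟨(CR : ℝ) * (3 * (9 * (cK * Ch * (cK * Ch)))), max (max a₁ a₂) (max aρ a₆),
    lt_max_of_lt_left (lt_max_of_lt_left ha₁), ?_⟩
  intro a ha S H 𝒟
  have ha12 : max a₁ a₂ ≤ a := le_trans (le_max_left _ _) ha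
  have ha₁' : a₁ ≤ a := le_trans (le_max_left _ _) ha12
  have ha₂' : a₂ ≤ a := le_trans (le_max_right _ _) ha12
  have haρ6 : max aρ a₆ ≤ a := le_trans (le_max_right _ _) ha
  have ha1 : (1 : ℝ) ≤ a := le_trans ha₁.le ha₁'
  obtain ⟨eP0, eP1⟩ := hP a ha₁' S (H.of_le (le_max_left _ _)) 𝒟
  obtain ⟨eC0, eC1⟩ := hC a ha₂' S (H.of_le (le_max_right _ _)) 𝒟
  have hsm : SmoothData ⟨β, α, a, b⟩ S 𝒟.cut.η 𝒟.D :=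
    H.smoothData ha1 (hρ a ((le_max_left _ _).trans haρ6) S.q) hc₀ 𝒟
  have hℓL : 1 ≤ mollScale β α a b S.q * freq a b (S.q + 1) := h64 a ((le_max_right _ _).trans haρ6) S.q
  -- the parameters at this stage
  set s : ℝ := Real.sqrt (amp β a b (S.q + 1)) with hs
  set L : ℝ := freq a b (S.q + 1) with hL
  set li : ℝ := (mollScale β α a b S.q)⁻¹ with hli
  have hs0 : 0 ≤ s := Real.sqrt_nonneg _
  have hL0 : 0 < L := freq_pos ha1 _
  have hL1 : 1 ≤ L := one_le_freq ha1 _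
  have hℓ0 : 0 < mollScale β α a b S.q := mollScale_pos ha1 _
  have hli0 : 0 < li := inv_pos.2 hℓ0
  have hliL : li * L⁻¹ ≤ 1 := by
    rw [hli, ← mul_inv, inv_le_one_iff₀]; exact Or.inr hℓL
  clear_value s L li
  intro t ht
  -- the fields at time `t`
  set u : UnitAddTorus (Fin 3) → EuclideanSpace ℝ (Fin 3) :=
    principalPart ⟨β, α, a, b⟩ S 𝔚 𝒟.cut.η 𝒟.D t with hu
  set w : UnitAddTorus (Fin 3) → EuclideanSpace ℝ (Fin 3) :=
    correctorPart ⟨β, α, a, b⟩ S 𝔚 𝒟.cut.η 𝒟.D t with hw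
  have hus : IsSmooth u := (hsm.principalPart 𝔚).isSmooth_slice ht
  have hws : IsSmooth w := (hsm.correctorPart 𝔚).isSmooth_slice ht
  -- pointwise bounds (with the common constant `Ch`)
  have hu0 : ∀ x, ‖u x‖ ≤ ((⟨Ch * s, mul_nonneg hCh0 hs0⟩ : ℝ≥0) : ℝ) := fun x =>
    (eP0 t ht x).trans (mul_le_mul_of_nonneg_right hC₁ hs0)
  have hu1 : ∀ i x, ‖Torus.partialDeriv i u x‖ ≤ ((⟨Ch * s * L, by positivity⟩ : ℝ≥0) : ℝ) := fun i x => by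
    refine (eP1 i t ht x).trans ?_
    show C₁ * (s * L) ≤ Ch * s * L
    nlinarith [mul_nonneg hs0 hL0.le]
  have hw0 : ∀ x, ‖w x‖ ≤ ((⟨Ch * s * li * L⁻¹, by positivity⟩ : ℝ≥0) : ℝ) := fun x => by
    refine (eC0 t ht x).trans ?_
    show C₂ * (s * li * L⁻¹) ≤ Ch * s * li * L⁻¹
    nlinarith [mul_nonneg (mul_nonneg hs0 hli0.le) (inv_nonneg.2 hL0.le)]
  have hw1 : ∀ i x, ‖Torus.partialDeriv i w x‖ ≤ ((⟨Ch * s * li, by positivity⟩ : ℝ≥0) : ℝ) := fun i x => by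
    refine (eC1 i t ht x).trans ?_
    show C₂ * (s * li) ≤ Ch * s * li
    nlinarith [mul_nonneg hs0 hli0.le]
  have hfun : oscCorrectorTensor ⟨β, α, a, b⟩ S 𝔚 𝒟.cut.η 𝒟.D t =
      fun y j => u y j • w y + w y j • u y + w y j • w y := rfl
  have hTs : IsSmooth (oscCorrectorTensor ⟨β, α, a, b⟩ S 𝔚 𝒟.cut.η 𝒟.D t) :=
    (hsm.oscCorrectorTensor 𝔚).isSmooth_slice ht
  clear_value u w
  -- interpolation at scale `Λ = λ_{q+1}`
  set Λ : ℝ≥0 := ⟨L, hL0.le⟩ with hΛ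
  have hΛ0 : 0 < Λ := hL0
  clear_value Λ
  have hHu := eHolderNorm_le_of_norm_le_of_norm_partialDeriv_le (hus.isContDiff (by simp)) hr1.le hΛ0
    hu0 hu1
  have hHw := eHolderNorm_le_of_norm_le_of_norm_partialDeriv_le (hws.isContDiff (by simp)) hr1.le hΛ0
    hw0 hw1
  -- the tensor and `ℛ div`
  have hT := eContDiffHolderNorm_correctorTensor_le hus hws r hu0 hw0 hHu hHw
  have hRt := hR (fun y j => u y j • w y + w y j • u y + w y j • w y) (by rw [← hfun]; exact hTs)
  -- assemble in `ℝ≥0∞`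
  rw [hrα]
  show Torus.eContDiffHolderNorm 0 r
      (Torus.antidivergence (Torus.tensorDivergence (oscCorrectorTensor ⟨β, α, a, b⟩ S 𝔚 𝒟.cut.η 𝒟.D t))) ≤ _
  rw [hfun]
  refine (hRt.trans (mul_le_mul_of_nonneg_left hT bot_le)).trans ?_
  rw [Fintype.card_fin, show ((3 : ℕ) : ℝ≥0∞) = ((3 : ℝ≥0) : ℝ≥0∞) by norm_cast, ← ENNReal.coe_mul,
    ← ENNReal.coe_mul, ← ENNReal.ofReal_coe_nnreal]
  refine ENNReal.ofReal_le_ofReal ?_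
  -- the real inequality
  push_cast
  simp only [hΛ, hr]
  -- name the bounds
  obtain ⟨U, hUdef⟩ : ∃ U : ℝ, U = cK * Ch * s * L ^ α := ⟨_, rfl⟩
  obtain ⟨V, hVdef⟩ : ∃ V : ℝ, V = cK * Ch * s * li * L ^ (-1 + α) := ⟨_, rfl⟩
  have hLα : 1 ≤ L ^ α := Real.one_le_rpow hL1 hα.le
  have hU0 : 0 ≤ U := by
    rw [hUdef]; exact mul_nonneg (mul_nonneg (mul_nonneg hcK0 hCh0) hs0) (Real.rpow_nonneg hL0.le _)
  have hV0 : 0 ≤ V := by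
    rw [hVdef]
    exact mul_nonneg (mul_nonneg (mul_nonneg (mul_nonneg hcK0 hCh0) hs0) hli0.le) (Real.rpow_nonneg hL0.le _)
  -- `L · L⁻¹^(1-α) = L^α`, `L⁻¹^(1-α) = L^(-1+α)`, `L⁻¹ L^α = L^(-1+α)`, `L⁻¹ ≤ L^(-1+α)`
  have e1 : L⁻¹ ^ (1 - α) = L ^ (-1 + α) := by
    rw [Real.inv_rpow hL0.le, ← Real.rpow_neg hL0.le]; congr 1; ring
  have e2 : L * L ^ (-1 + α) = L ^ α := by
    rw [mul_comm, rpow_mul_self_eq hL0]; congr 1; ring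
  have e3 : L⁻¹ * L ^ α = L ^ (-1 + α) := by
    rw [← Real.rpow_neg_one, ← Real.rpow_add hL0]
  have e4 : L⁻¹ ≤ L ^ (-1 + α) := by
    rw [← Real.rpow_neg_one]; exact Real.rpow_le_rpow_of_exponent_le hL1 (by linarith)
  have e5 : li * L ^ (-1 + α) ≤ L ^ α := by
    rw [← e3, ← mul_assoc]
    exact mul_le_of_le_one_left (by positivity) hliL
  -- the four bounds and their sizes
  have hChs : 0 ≤ Ch * s := mul_nonneg hCh0 hs0
  have hm : Ch * s ≤ U := by
    rw [hUdef]
    calc Ch * s = 1 * (Ch * s) * 1 := by ring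
      _ ≤ cK * (Ch * s) * L ^ α :=
          mul_le_mul (mul_le_mul_of_nonneg_right hcK1 hChs) hLα zero_le_one
            (mul_nonneg hcK0 hChs)
      _ = _ := by ring
  have hHuU : √3 * (3 * (Ch * s * L)) * L⁻¹ ^ (1 - α) + 2 * (Ch * s) * L ^ α ≤ U := by
    rw [e1, hUdef, hcK, show √3 * (3 * (Ch * s * L)) * L ^ (-1 + α) =
      √3 * 3 * (Ch * s) * (L * L ^ (-1 + α)) by ring, e2]
    apply le_of_eq; ring
  have hn : Ch * s * li * L⁻¹ ≤ U := by
    calc Ch * s * li * L⁻¹ = Ch * s * (li * L⁻¹) := by ring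
      _ ≤ Ch * s * 1 := mul_le_mul_of_nonneg_left hliL hChs
      _ = Ch * s := mul_one _
      _ ≤ U := hm
  have hHwV : √3 * (3 * (Ch * s * li)) * L⁻¹ ^ (1 - α) + 2 * (Ch * s * li * L⁻¹) * L ^ α = V := by
    rw [e1, hVdef, hcK, show 2 * (Ch * s * li * L⁻¹) * L ^ α = 2 * (Ch * s * li) * (L⁻¹ * L ^ α) by ring, e3]
    ring
  have hHwU : √3 * (3 * (Ch * s * li)) * L⁻¹ ^ (1 - α) + 2 * (Ch * s * li * L⁻¹) * L ^ α ≤ U := by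
    rw [hHwV, hVdef, hUdef]
    calc cK * Ch * s * li * L ^ (-1 + α) = cK * Ch * s * (li * L ^ (-1 + α)) := by ring
      _ ≤ cK * Ch * s * L ^ α :=
          mul_le_mul_of_nonneg_left e5 (mul_nonneg (mul_nonneg hcK0 hCh0) hs0)
  have hnV : Ch * s * li * L⁻¹ ≤ V := by
    rw [hVdef]
    have hChsl : 0 ≤ Ch * s * li := mul_nonneg hChs hli0.le
    calc Ch * s * li * L⁻¹ = 1 * (Ch * s * li) * L⁻¹ := by ring
      _ ≤ cK * (Ch * s * li) * L ^ (-1 + α) :=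
          mul_le_mul (mul_le_mul_of_nonneg_right hcK1 hChsl) e4 (inv_nonneg.2 hL0.le)
            (mul_nonneg hcK0 hChsl)
      _ = _ := by ring
  have hnine := colBound_le_nine (U := U) (V := V) (by positivity) (by positivity) (by positivity)
    (by positivity) hU0 hV0 hm hHuU hn hHwU hnV (le_of_eq hHwV)
  -- `U V = cK² Ch² (δ_{q+1} ℓ⁻¹ λ_{q+1}^{-1+2α}) ≤ cK² Ch² · scale`
  have hUV : U * V ≤ cK * Ch * (cK * Ch) *
      (s * Real.sqrt (amp β a b S.q) * freq a b S.q * L ^ (-1 + 4 * α)) := by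
    have hsc := correctorScale_le_stressScale (β := β) (α := α) ha1 hb.le hα.le S.q
    rw [← hs, ← hli, ← hL] at hsc
    have hss : s * s = amp β a b (S.q + 1) := by
      rw [hs]; exact Real.mul_self_sqrt (amp_pos ha1 _).le
    have e6 : U * V = cK * Ch * (cK * Ch) * (amp β a b (S.q + 1) * li * L ^ (-1 + 2 * α)) := by
      rw [hUdef, hVdef, ← hss, show (-1 + 2 * α) = α + (-1 + α) by ring, Real.rpow_add hL0 α (-1 + α)]
      ring
    rw [e6]
    exact mul_le_mul_of_nonneg_left hsc (mul_nonneg (mul_nonneg hcK0 hCh0) (mul_nonneg hcK0 hCh0))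
  refine le_trans (mul_le_mul_of_nonneg_left (mul_le_mul_of_nonneg_left hnine (by norm_num))
    (NNReal.coe_nonneg CR)) ?_
  calc (CR : ℝ) * (3 * (9 * (U * V)))
      ≤ (CR : ℝ) * (3 * (9 * (cK * Ch * (cK * Ch) *
          (s * Real.sqrt (amp β a b S.q) * freq a b S.q * L ^ (-1 + 4 * α))))) :=
        mul_le_mul_of_nonneg_left (mul_le_mul_of_nonneg_left
          (mul_le_mul_of_nonneg_left hUV (by norm_num)) (by norm_num)) (NNReal.coe_nonneg CR)
    _ = _ := by ring

end DeRosa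

/-! ## Port of `OnsagerBDSVNashErrorProof` -/

namespace DeRosa

open BDSV

open FunctionSpaces FunctionSpaces.Torus

/-- The flat three-torus `T³ = (ℝ/ℤ)³`, local notation. -/
local notation "𝕋³" => UnitAddTorus (Fin 3)

/-- Euclidean `ℝ³`, local notation. -/
local notation "ℝ³" => EuclideanSpace ℝ (Fin 3)

/-- Real `3 × 3` matrices, local notation. -/
local notation "𝕄" => Matrix (Fin 3) (Fin 3) ℝ

end DeRosa

namespace DeRosa

open BDSV

open FunctionSpaces FunctionSpaces.Torus

/-- The flat three-torus `T³ = (ℝ/ℤ)³`, local notation. -/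
local notation "𝕋³" => UnitAddTorus (Fin 3)

/-- Euclidean `ℝ³`, local notation. -/
local notation "ℝ³" => EuclideanSpace ℝ (Fin 3)

/-- Real `3 × 3` matrices, local notation. -/
local notation "𝕄" => Matrix (Fin 3) (Fin 3) ℝ

section Pointwise

variable {P : Params} {S : Setting} {Nbar : ℕ} {Cin C₀ c₀ : ℝ} {Cη : ℕ → ℕ → ℝ}

/-- **Sup bound on the potential `Z`** (as in the first estimate of the proof of Prop. 6.2, where
`‖Z‖₀ ≲ δ_{q+1}^{1/2}` is used after one integration by parts): under the standing hypotheses with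
`C_in ≥ 0`, `c₀ > 0`, `a ≥ 1` and `4δ_{q+2} ≤ δ_{q+1}λ_q^{-α}`, if the Mikado potential `V` is bounded
by `K_V` on the ball `‖R‖_∞ ≤ 9e^{8C_in}(1 + 8C_in)`, then
`‖Z(t,x)‖ ≤ (9 e^{4C_in} K_V / c₀^{1/2}) δ_{q+1}^{1/2}` on `[0,T] × T³`: at each point at most one
cut-off is active, `|ρ_{q,i}^{1/2}| ≤ (δ_{q+1}/c₀)^{1/2}` (Lemma 5.4), `‖∇Φ_iᵀ‖_∞ ≤ e^{4C_in}` on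
`supp η_i` (Lemma 5.4 (5.14)) and `R̃_{q,i}` stays in the ball (Remark 5.2).
[cite: BuckmasterEtAl2018, Prop. 6.2 (proof, first estimate) with Lemma 5.4] -/
theorem PerturbationData.norm_potential_le (H : CoreHypotheses P S Nbar Cin C₀)
    (𝒟 : PerturbationData P S c₀ Cη) (𝔚 : MikadoDatum mikadoRadius) (hc₀ : 0 < c₀) (hCin : 0 ≤ Cin)
    (ha : 1 ≤ P.a) (hb : 1 ≤ P.b) (hβ : 0 ≤ P.β) (hα : 0 ≤ P.α)
    (h4 : 4 * amp P.β P.a P.b (S.q + 2) ≤ amp P.β P.a P.b (S.q + 1) * freq P.a P.b S.q ^ (-P.α))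
    {KV : ℝ} (hKV0 : 0 ≤ KV)
    (hKV : ∀ R ∈ Metric.closedBall (0 : 𝕄) (9 * Real.exp (8 * Cin) * (1 + 8 * Cin)),
      ∀ ξ : 𝕋³, ‖𝔚.V R ξ‖ ≤ KV)
    {t : ℝ} (ht : t ∈ Icc 0 S.T) (x : 𝕋³) :
    ‖potential P S 𝔚 𝒟.cut.η 𝒟.D t x‖ ≤
      9 * Real.exp (4 * Cin) * KV / Real.sqrt c₀ * Real.sqrt (amp P.β P.a P.b (S.q + 1)) := by
  set B : ℝ := 9 * Real.exp (4 * Cin) * KV / Real.sqrt c₀ * Real.sqrt (amp P.β P.a P.b (S.q + 1))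
    with hB
  have hB0 : 0 ≤ B := by positivity
  refine 𝒟.cut.norm_sum_le t x hB0 (fun i hi => by rw [sqrtRhoI, hi, zero_mul, zero_smul]) ?_ _
  intro i
  by_cases hη : 𝒟.cut.η i t x = 0
  · rw [sqrtRhoI, hη, zero_mul, zero_smul, norm_zero]
    exact hB0
  · rw [norm_smul, Real.norm_eq_abs]
    have h1 := 𝒟.abs_sqrtRhoI_le H hc₀ ha ht i x
    have hG : ‖(gradPhi 𝒟.D i t x)ᵀ‖ ≤ Real.exp (4 * Cin) := by
      rw [Matrix.norm_transpose]
      exact 𝒟.norm_gradPhi_le H hCin ha hb hβ hα ht hη x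
    have hRt : tildeR P S 𝒟.cut.η 𝒟.D i t x ∈
        Metric.closedBall (0 : 𝕄) (9 * Real.exp (8 * Cin) * (1 + 8 * Cin)) := by
      rw [Metric.mem_closedBall, dist_zero_right]
      exact 𝒟.norm_tildeR_le H hCin ha hb hβ hα h4 ht hη x
    have hVle := hKV _ hRt (P.freqNat (S.q + 1) • phiPoint 𝒟.D i t x)
    have h2 := norm_toEuclideanLin_le (gradPhi 𝒟.D i t x)ᵀ
      (𝔚.V (tildeR P S 𝒟.cut.η 𝒟.D i t x) (P.freqNat (S.q + 1) • phiPoint 𝒟.D i t x))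
    have h3 : 9 * ‖(gradPhi 𝒟.D i t x)ᵀ‖ *
        ‖𝔚.V (tildeR P S 𝒟.cut.η 𝒟.D i t x) (P.freqNat (S.q + 1) • phiPoint 𝒟.D i t x)‖ ≤
        9 * Real.exp (4 * Cin) * KV :=
      mul_le_mul (mul_le_mul_of_nonneg_left hG (by norm_num)) hVle (norm_nonneg _) (by positivity)
    have hsq : Real.sqrt (amp P.β P.a P.b (S.q + 1) / c₀) =
        Real.sqrt (amp P.β P.a P.b (S.q + 1)) / Real.sqrt c₀ := Real.sqrt_div (amp_pos ha _).le c₀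
    calc |sqrtRhoI P S 𝒟.cut.η i t x| *
          ‖Matrix.toEuclideanLin (gradPhi 𝒟.D i t x)ᵀ
            (𝔚.V (tildeR P S 𝒟.cut.η 𝒟.D i t x) (P.freqNat (S.q + 1) • phiPoint 𝒟.D i t x))‖
        ≤ Real.sqrt (amp P.β P.a P.b (S.q + 1) / c₀) * (9 * Real.exp (4 * Cin) * KV) :=
          mul_le_mul h1 (h2.trans h3) (norm_nonneg _) (Real.sqrt_nonneg _)
      _ = B := by rw [hB, hsq]; ring

/-- **The derivative of the Mikado factor `V(R̃_{q,i}, n_{q+1}Φ_i)`** (the chain rule (5.34) through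
the phase plus the slow derivative through the matrix argument, for the potential profile `V` in
place of `W`): if `‖D¹V‖ ≤ C_V` on `B̄(0, ρ) × ℝ³` with `R̃_{q,i}(t,x) ∈ B̄(0,ρ)` and
`‖∂ⱼR̃_{q,i}(t,x)‖ ≤ R₁`, then `‖∂ⱼ[V(R̃_{q,i}, n_{q+1}Φ_i)](t,x)‖ ≤ C_V (R₁ + 3 n_{q+1} e^{4C_in})`.
[cite: BuckmasterEtAl2018, Cor. 5.8 (proof, arXiv (5.34))] -/
theorem PerturbationData.norm_partialDeriv_mikadoV_le (H : CoreHypotheses P S Nbar Cin C₀)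
    (𝒟 : PerturbationData P S c₀ Cη) (𝔚 : MikadoDatum mikadoRadius) (hCin : 0 ≤ Cin) (ha : 1 ≤ P.a)
    (hb : 1 ≤ P.b) (hβ : 0 ≤ P.β) (hα : 0 ≤ P.α) (hρ : ∀ s ∈ Icc 0 S.T, rhoQ P S s ≠ 0)
    {i : ℕ} {t : ℝ} (ht : t ∈ Icc 0 S.T) {x' : 𝕋³} (hη : 𝒟.cut.η i t x' ≠ 0) {ρ CV R₁ : ℝ}
    (hCV0 : 0 ≤ CV)
    (hCV : ∀ R ∈ Metric.closedBall (0 : 𝕄) ρ, ∀ ξ : ℝ³, ‖iteratedFDeriv ℝ 1 (mikadoLift 𝔚.V) (R, ξ)‖ ≤ CV)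
    {j : Fin 3} {x : 𝕋³} (hRt : tildeR P S 𝒟.cut.η 𝒟.D i t x ∈ Metric.closedBall (0 : 𝕄) ρ)
    (hR1 : ‖Torus.partialDeriv j (tildeR P S 𝒟.cut.η 𝒟.D i t) x‖ ≤ R₁) :
    ‖Torus.partialDeriv j (fun y => 𝔚.V (tildeR P S 𝒟.cut.η 𝒟.D i t y)
        (P.freqNat (S.q + 1) • phiPoint 𝒟.D i t y)) x‖ ≤
      CV * (R₁ + P.freqNat (S.q + 1) * (3 * Real.exp (4 * Cin))) := by
  have hDt : IsSmooth (𝒟.D i t) := (𝒟.flow i).smooth.isSmooth_slice ht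
  have hRm : IsSmooth (tildeR P S 𝒟.cut.η 𝒟.D i t) :=
    isSmooth_matrix_of_entries fun a b =>
      (isSmoothSpaceTimeOn_tildeR H.pos_T H.profile.smooth H.eulerReynolds.smooth_velocity
        H.eulerReynolds.smooth_stress 𝒟.cut.smooth (fun k => (𝒟.flow k).smooth) hρ i a b).isSmooth_slice ht
  have h := norm_partialDeriv_mikado_comp_le (V := 𝔚.V) 𝔚.smooth_V hRm hDt (P.freqNat (S.q + 1))
    hCV0 (fun ξ => hCV _ hRt ξ) j
  refine h.trans (mul_le_mul_of_nonneg_left (max_le ?_ ?_) hCV0)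
  · exact hR1.trans (le_add_of_nonneg_right (by positivity))
  · refine le_add_of_nonneg_of_le ((norm_nonneg _).trans hR1) ?_
    exact mul_le_mul_of_nonneg_left ((norm_single_add_partialDeriv_le 𝒟.D i t x j).trans
      (mul_le_mul_of_nonneg_left (𝒟.norm_gradPhi_le H hCin ha hb hβ hα ht hη x) (by norm_num)))
      (Nat.cast_nonneg _)

/-- **The derivative bound on `Z` at fixed parameters** (the computation of arXiv (5.35) for the
potential in place of `w_o`, with unspecified constants): under the standing hypotheses with
`N̄ ≥ 1`, `C_in ≥ 0`, `c₀ > 0`, `a ≥ 1`, `4δ_{q+2} ≤ δ_{q+1}λ_q^{-α}`, given bounds `K_V` on `V` and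
`C_V` on `D¹V` over the ball `‖R‖_∞ ≤ 9e^{8C_in}(1 + 8C_in)` (Remark 5.2) and a `C¹` bound `B₁` on
`∇Φ_i` over `Ĩ_i` (Prop. 5.7 (5.23)), every first spatial derivative of `Z` is bounded on
`[0,T] × T³` by
`9 (δ_{q+1}/c₀)^{1/2} [e^{4C_in}(C_V(9e^{4C_in}(2(1+8C_in)B₁ + 8C_in e^{4C_in}ℓ⁻¹) + 3n_{q+1}e^{4C_in})) + B₁K_V + max(C(0,1),0)·e^{4C_in}K_V]`
(by the Leibniz rule for `ρ_{q,i}^{1/2} • ∇Φ_iᵀ V`: Lemmas 5.3–5.4 for `∂ⱼρ_{q,i}^{1/2}`, (5.23) for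
`∂ⱼ∇Φ_iᵀ`, (5.24) for `∂ⱼR̃_{q,i}`, the chain rule (5.34); at most one cut-off is active at each
point and `∂ⱼZ_i = 0` off `supp η_i`). [cite: BuckmasterEtAl2018, Cor. 5.8 (proof, arXiv (5.33)–(5.35))] -/
theorem PerturbationData.norm_partialDeriv_potential_le (H : CoreHypotheses P S Nbar Cin C₀)
    (𝒟 : PerturbationData P S c₀ Cη) (𝔚 : MikadoDatum mikadoRadius) (hN : 1 ≤ Nbar) (hc₀ : 0 < c₀)
    (hCin : 0 ≤ Cin) (ha : 1 ≤ P.a) (hb : 1 ≤ P.b) (hβ : 0 ≤ P.β) (hα : 0 ≤ P.α)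
    (h4 : 4 * amp P.β P.a P.b (S.q + 2) ≤ amp P.β P.a P.b (S.q + 1) * freq P.a P.b S.q ^ (-P.α))
    {KV CV B₁ : ℝ} (hKV0 : 0 ≤ KV)
    (hKV : ∀ R ∈ Metric.closedBall (0 : 𝕄) (9 * Real.exp (8 * Cin) * (1 + 8 * Cin)),
      ∀ ξ : 𝕋³, ‖𝔚.V R ξ‖ ≤ KV)
    (hCV0 : 0 ≤ CV)
    (hCV : ∀ R ∈ Metric.closedBall (0 : 𝕄) (9 * Real.exp (8 * Cin) * (1 + 8 * Cin)),
      ∀ ξ : ℝ³, ‖iteratedFDeriv ℝ 1 (mikadoLift 𝔚.V) (R, ξ)‖ ≤ CV)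
    (hB₁ : 0 ≤ B₁)
    (hG1 : ∀ i, HolderSupOnLE (tildeInterval S.T (P.τ S.q) i) (fun s y => gradPhi 𝒟.D i s y) 1 0 B₁)
    {t : ℝ} (ht : t ∈ Icc 0 S.T) (j : Fin 3) (x : 𝕋³) :
    ‖Torus.partialDeriv j (potential P S 𝔚 𝒟.cut.η 𝒟.D t) x‖ ≤
      9 * Real.sqrt (amp P.β P.a P.b (S.q + 1) / c₀) *
        (Real.exp (4 * Cin) *
            (CV * (9 * Real.exp (4 * Cin) * (2 * (1 + 8 * Cin) * B₁ +
              Real.exp (4 * Cin) * (8 * Cin * (mollScale P.β P.α P.a P.b S.q)⁻¹)) +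
              P.freqNat (S.q + 1) * (3 * Real.exp (4 * Cin)))) +
          B₁ * KV + max (Cη 0 1) 0 * Real.exp (4 * Cin) * KV) := by
  -- `ρ_q > 0`, smooth data, smooth factors of the summands at time `t`
  have hρpos : ∀ s ∈ Icc 0 S.T, 0 < rhoQ P S s := fun s hs =>
    lt_of_lt_of_le (div_pos (mul_pos (amp_pos ha _) (Real.rpow_pos_of_pos (freq_pos ha _) _))
      (by norm_num)) (H.le_rhoQ h4 hs)
  have hSD : SmoothData P S 𝒟.cut.η 𝒟.D := H.toSmoothData hc₀ 𝒟 hρpos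
  have hf : ∀ i, IsSmooth (sqrtRhoI P S 𝒟.cut.η i t) := fun i => (hSD.sqrtRhoI i).isSmooth_slice ht
  have hGm : ∀ i, IsSmooth (gradPhi 𝒟.D i t) := fun i =>
    isSmooth_matrix_of_entries fun a b => isSmooth_gradPhi_entry ((𝒟.flow i).smooth.isSmooth_slice ht) a b
  have hA : ∀ i, IsSmooth (fun y => (gradPhi 𝒟.D i t y)ᵀ) := fun i => (hGm i).comp_clm mtranspose
  have hv : ∀ i, IsSmooth (fun y => 𝔚.V (tildeR P S 𝒟.cut.η 𝒟.D i t y)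
      (P.freqNat (S.q + 1) • phiPoint 𝒟.D i t y)) := fun i => (hSD.mikadoV 𝔚 i).isSmooth_slice ht
  have hs : ∀ i, IsSmooth (potentialSummand P S 𝔚 𝒟.cut.η 𝒟.D i t) := fun i =>
    (hf i).smul' (isSmooth_toEuclideanLin (hA i) (hv i))
  -- the bound is nonnegative
  set E : ℝ := Real.exp (4 * Cin) with hE
  have hE0 : 0 ≤ E := (Real.exp_pos _).le
  set B : ℝ := 9 * Real.sqrt (amp P.β P.a P.b (S.q + 1) / c₀) *
        (E * (CV * (9 * E * (2 * (1 + 8 * Cin) * B₁ + E * (8 * Cin * (mollScale P.β P.α P.a P.b S.q)⁻¹)) +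
              P.freqNat (S.q + 1) * (3 * E))) +
          B₁ * KV + max (Cη 0 1) 0 * E * KV) with hB
  have hℓ : 0 < mollScale P.β P.α P.a P.b S.q := mollScale_pos ha _
  have hCη0 : 0 ≤ max (Cη 0 1) 0 := le_max_right _ _
  have hB0 : 0 ≤ B := by positivity
  -- vanishing of `∂ⱼ Z_i` off `supp η_i`
  have hzero : ∀ i, 𝒟.cut.η i t x = 0 →
      Torus.partialDeriv j (potentialSummand P S 𝔚 𝒟.cut.η 𝒟.D i t) x = 0 :=
    fun i hi => partialDeriv_smul_toEuclideanLin_eq_zero (hf i) (hA i) (hv i)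
      (by rw [sqrtRhoI, hi, zero_mul]) (𝒟.partialDeriv_sqrtRhoI_eq_zero ht hi j)
  have e : potential P S 𝔚 𝒟.cut.η 𝒟.D t = fun y =>
      ∑ i ∈ Finset.range (cutoffCount S.T (P.τ S.q)), potentialSummand P S 𝔚 𝒟.cut.η 𝒟.D i t y := rfl
  rw [e, partialDeriv_finset_sum _ (fun i _ => (hs i).isContDiff (by simp)) j x]
  refine 𝒟.cut.norm_sum_le t x hB0 hzero (fun i => ?_) _
  by_cases hi : 𝒟.cut.η i t x = 0
  · rw [hzero i hi, norm_zero]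
    exact hB0
  · -- the bounds on the three factors at `(t, x)`, where `η_i(t,x) ≠ 0`
    have hRt : tildeR P S 𝒟.cut.η 𝒟.D i t x ∈
        Metric.closedBall (0 : 𝕄) (9 * Real.exp (8 * Cin) * (1 + 8 * Cin)) := by
      rw [Metric.mem_closedBall, dist_zero_right]
      exact 𝒟.norm_tildeR_le H hCin ha hb hβ hα h4 ht hi x
    have h1 := 𝒟.abs_sqrtRhoI_le H hc₀ ha ht i x
    have h2 := 𝒟.abs_partialDeriv_sqrtRhoI_le H hc₀ ha (i := i) ht j x
    have h3 : ‖(gradPhi 𝒟.D i t x)ᵀ‖ ≤ E := by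
      rw [Matrix.norm_transpose]
      exact 𝒟.norm_gradPhi_le H hCin ha hb hβ hα ht hi x
    have h4' : ‖Torus.partialDeriv j (fun y => (gradPhi 𝒟.D i t y)ᵀ) x‖ ≤ B₁ := by
      have hd : Torus.partialDeriv j (fun y => (gradPhi 𝒟.D i t y)ᵀ) x = (Torus.partialDeriv j (gradPhi 𝒟.D i t) x)ᵀ :=
        partialDeriv_clm_comp (hGm i) mtranspose j x
      rw [hd, Matrix.norm_transpose]
      exact 𝒟.norm_partialDeriv_gradPhi_le ht hi hB₁ (hG1 i) j x
    have h5 : ‖𝔚.V (tildeR P S 𝒟.cut.η 𝒟.D i t x) (P.freqNat (S.q + 1) • phiPoint 𝒟.D i t x)‖ ≤ KV :=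
      hKV _ hRt _
    have hR1 := 𝒟.norm_partialDeriv_tildeR_le H hN hCin ha hb hβ hα h4 ht hi hB₁ (hG1 i) j x
    have h6 := 𝒟.norm_partialDeriv_mikadoV_le H 𝔚 hCin ha hb hβ hα (fun s hs => (hρpos s hs).ne')
      ht hi hCV0 hCV hRt hR1
    refine (norm_partialDeriv_smul_toEuclideanLin_le (hf i) (hA i) (hv i) (Real.sqrt_nonneg _)
      (mul_nonneg hCη0 (Real.sqrt_nonneg _)) hE0 h1 h2 h3 h4' h5 h6).trans (le_of_eq ?_)
    rw [hB]
    ring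

end Pointwise

section PotentialBound

/-- **`‖Z‖₀ ≲ δ_{q+1}^{1/2}` and `‖∇Z‖₀ ≲ δ_{q+1}^{1/2} λ_{q+1}` along the common prefix** (the
analogue for the potential `Z` of Cor. 5.8 (5.29) for `w_o`, with the same proof: the sup half is
`BDSV.PerturbationData.norm_potential_le`; the derivative half
`BDSV.PerturbationData.norm_partialDeriv_potential_le` gives `‖∇Z‖₀ ≲ δ_{q+1}^{1/2}(ℓ⁻¹ + n_{q+1} + 1)`,
and arXiv (6.6) `ℓ⁻¹ ≤ λ_{q+1}` (for `3α < 2(1-β)(b-1)`, `a` large), `n_{q+1} ≤ λ_{q+1}`,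
`1 ≤ λ_{q+1}` conclude). Thresholds: `α < min(α₀(5.23), βb(b-1), (1-β)(b-1)/3)`,
`N̄ = max(N̄(5.23), 1)`, `a` beyond the thresholds of (5.23), of `4δ_{q+2} ≤ δ_{q+1}λ_q^{-α}` and of
(6.6). [cite: BuckmasterEtAl2018, Cor. 5.8 (proof, arXiv (5.33)–(5.35)) and §5.3 (5.28)] -/
theorem potentialBound_stageFact :
    StageFact fun 𝔚 P C S _ _ 𝒟 =>
      SupLE S.T (potential P S 𝔚 𝒟.cut.η 𝒟.D) (C * Real.sqrt (amp P.β P.a P.b (S.q + 1))) ∧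
        DerivSupLE S.T (potential P S 𝔚 𝒟.cut.η 𝒟.D)
          (C * (Real.sqrt (amp P.β P.a P.b (S.q + 1)) * freq P.a P.b (S.q + 1))) := by
  intro 𝔚 c₀ hc₀ Cη β hβ hβ3 b hb1 hb2
  -- Prop. 5.7 (5.23), proved in the tree
  obtain ⟨αG, hαG, hG⟩ := gradPhiBound_holds c₀ hc₀ Cη β hβ hβ3 b hb1 hb2
  have hb0 : (0 : ℝ) < b := by linarith
  have hbm : (0 : ℝ) < b - 1 := by linarith
  have h1β : (0 : ℝ) < 1 - β := by linarith
  refine ⟨min αG (min (β * b * (b - 1)) ((1 - β) * (b - 1) / 3)),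
    lt_min hαG (lt_min (mul_pos (mul_pos hβ hb0) hbm) (div_pos (mul_pos h1β hbm) (by norm_num))),
    fun α hα hαlt => ?_⟩
  have hαG' : α < αG := lt_of_lt_of_le hαlt (min_le_left _ _)
  have hαb : α < 2 * β * b * (b - 1) := by
    have := lt_of_lt_of_le hαlt ((min_le_right _ _).trans (min_le_left _ _))
    nlinarith [mul_pos hβ hb0]
  have hα66 : 3 * α < 2 * (1 - β) * (b - 1) := by
    have := lt_of_lt_of_le hαlt ((min_le_right _ _).trans (min_le_right _ _))
    nlinarith [mul_pos h1β hbm]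
  obtain ⟨NG, hG⟩ := hG α hα hαG' 1
  refine ⟨max NG 1, fun Cin C₀ => ?_⟩
  obtain ⟨C₁, aG, haG, hG⟩ := hG Cin C₀
  -- the constants
  set Cp : ℝ := max Cin 0 with hCp
  have hCp0 : 0 ≤ Cp := le_max_right _ _
  obtain ⟨KV, hKV0, hKV⟩ := 𝔚.exists_bound_V
    (isCompact_closedBall (0 : 𝕄) (9 * Real.exp (8 * Cp) * (1 + 8 * Cp)))
  obtain ⟨CV, hCV0, hCV⟩ := exists_forall_norm_iteratedFDeriv_mikadoLift_le 𝔚.contDiff_mikadoLift_V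
    (isCompact_closedBall (0 : 𝕄) (9 * Real.exp (8 * Cp) * (1 + 8 * Cp))) 1
  set C₁p : ℝ := max C₁ 0 with hC₁p
  have hC₁p0 : 0 ≤ C₁p := le_max_right _ _
  have hCη0 : 0 ≤ max (Cη 0 1) 0 := le_max_right _ _
  set E : ℝ := Real.exp (4 * Cp) with hE
  have hE0 : 0 ≤ E := (Real.exp_pos _).le
  -- the coefficients of `ℓ⁻¹`, of `n_{q+1}` and of `1` in the derivative bound, and the two constants
  set A₁ : ℝ := E * (CV * (9 * E * (2 * (1 + 8 * Cp) * C₁p + E * (8 * Cp)))) + C₁p * KV with hA₁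
  set A₂ : ℝ := E * (CV * (3 * E)) with hA₂
  set A₃ : ℝ := max (Cη 0 1) 0 * E * KV with hA₃
  have hA₁0 : 0 ≤ A₁ := by positivity
  have hA₂0 : 0 ≤ A₂ := by positivity
  have hA₃0 : 0 ≤ A₃ := by positivity
  set Ko : ℝ := 9 * Real.exp (4 * Cp) * KV / Real.sqrt c₀ with hKo
  set Kd : ℝ := 9 / Real.sqrt c₀ * (A₁ + A₂ + A₃) with hKd
  obtain ⟨a₄, ha₄, h4⟩ := exists_threshold_four_amp hb1 hαb
  obtain ⟨a₆, ha₆, h66⟩ := exists_threshold_mollScale_inv_mul_freq_inv_le_one hb1.le hα66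
  refine ⟨max Ko Kd, max aG (max a₄ a₆), lt_max_of_lt_left haG, fun a ha S H 𝒟 => ?_⟩
  have haG' : aG ≤ a := (le_max_left _ _).trans ha
  have ha₄' : a₄ ≤ a := ((le_max_left _ _).trans (le_max_right _ _)).trans ha
  have ha₆' : a₆ ≤ a := ((le_max_right _ _).trans (le_max_right _ _)).trans ha
  have ha1 : (1 : ℝ) ≤ a := haG.le.trans haG'
  have h4q := h4 a ha₄' S.q
  -- the standing hypotheses at the two orders used, with `C_in` replaced by `max C_in 0`
  have HG : CoreHypotheses ⟨β, α, a, b⟩ S NG Cin C₀ := H.of_le (le_max_left _ _)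
  have H1 : CoreHypotheses ⟨β, α, a, b⟩ S 1 Cp C₀ :=
    (H.of_le (le_max_right _ _)).mono_const ha1 (le_max_left _ _)
  -- (5.23) at `N = 1`, with the constant `C₁p ℓ⁻¹`
  have hℓ : 0 < mollScale β α a b S.q := mollScale_pos ha1 _
  have hmono : C₁ * mollScale β α a b S.q ^ (-((1 : ℕ) : ℝ)) ≤ C₁p * (mollScale β α a b S.q)⁻¹ := by
    rw [Nat.cast_one, Real.rpow_neg_one]
    exact mul_le_mul_of_nonneg_right (le_max_left _ _) (inv_nonneg.2 hℓ.le)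
  have hG1 : ∀ i, HolderSupOnLE (tildeInterval S.T (Params.τ ⟨β, α, a, b⟩ S.q) i)
      (fun s y => gradPhi 𝒟.D i s y) 1 0 (C₁p * (mollScale β α a b S.q)⁻¹) :=
    fun i => (hG a haG' S HG 𝒟 i).1.mono hmono
  -- scales
  have hf1 : 0 < freq a b (S.q + 1) := freq_pos ha1 _
  have h1f : 1 ≤ freq a b (S.q + 1) := one_le_freq ha1 _
  have hL : (mollScale β α a b S.q)⁻¹ ≤ freq a b (S.q + 1) := by
    have h := h66 a ha₆' S.q
    calc (mollScale β α a b S.q)⁻¹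
        = (mollScale β α a b S.q)⁻¹ * (freq a b (S.q + 1))⁻¹ * freq a b (S.q + 1) := by
          field_simp
      _ ≤ 1 * freq a b (S.q + 1) := mul_le_mul_of_nonneg_right h hf1.le
      _ = freq a b (S.q + 1) := one_mul _
  have hn : (Params.freqNat ⟨β, α, a, b⟩ (S.q + 1) : ℝ) ≤ freq a b (S.q + 1) :=
    Params.freqNat_le_freq ⟨β, α, a, b⟩ (by show (0 : ℝ) ≤ a; linarith) (S.q + 1)
  have hσ : Real.sqrt (amp β a b (S.q + 1) / c₀) = Real.sqrt (amp β a b (S.q + 1)) / Real.sqrt c₀ :=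
    Real.sqrt_div (amp_pos ha1 _).le c₀
  constructor
  · -- the sup bound
    intro t ht x
    have h := 𝒟.norm_potential_le H1 𝔚 hc₀ hCp0 ha1 hb1.le hβ.le hα.le h4q hKV0 hKV ht x
    exact h.trans (mul_le_mul_of_nonneg_right (le_max_left _ _) (Real.sqrt_nonneg _))
  · -- the derivative bound and (6.6)
    intro j t ht x
    have hpt : ‖Torus.partialDeriv j (potential ⟨β, α, a, b⟩ S 𝔚 𝒟.cut.η 𝒟.D t) x‖ ≤
        9 * Real.sqrt (amp β a b (S.q + 1) / c₀) *
          (Real.exp (4 * Cp) *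
              (CV * (9 * Real.exp (4 * Cp) * (2 * (1 + 8 * Cp) * (C₁p * (mollScale β α a b S.q)⁻¹) +
                Real.exp (4 * Cp) * (8 * Cp * (mollScale β α a b S.q)⁻¹)) +
                (Params.freqNat ⟨β, α, a, b⟩ (S.q + 1) : ℝ) * (3 * Real.exp (4 * Cp)))) +
            C₁p * (mollScale β α a b S.q)⁻¹ * KV +
            max (Cη 0 1) 0 * Real.exp (4 * Cp) * KV) :=
      𝒟.norm_partialDeriv_potential_le H1 𝔚 le_rfl hc₀ hCp0 ha1 hb1.le hβ.le hα.le h4q hKV0 hKV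
        hCV0 hCV (B₁ := C₁p * (mollScale β α a b S.q)⁻¹) (by positivity) hG1 ht j x
    rw [← hE] at hpt
    set L : ℝ := (mollScale β α a b S.q)⁻¹ with hLdef
    set nn : ℝ := (Params.freqNat ⟨β, α, a, b⟩ (S.q + 1) : ℝ) with hnn
    set lam : ℝ := freq a b (S.q + 1) with hlam
    have hL0 : 0 ≤ L := inv_nonneg.2 hℓ.le
    have hnn0 : 0 ≤ nn := Nat.cast_nonneg _
    -- the bracket is `A₁ L + A₂ n + A₃ ≤ (A₁ + A₂ + A₃) λ_{q+1}`
    have hT : E * (CV * (9 * E * (2 * (1 + 8 * Cp) * (C₁p * L) + E * (8 * Cp * L)) +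
        nn * (3 * E))) + C₁p * L * KV + max (Cη 0 1) 0 * E * KV ≤ (A₁ + A₂ + A₃) * lam := by
      have e : E * (CV * (9 * E * (2 * (1 + 8 * Cp) * (C₁p * L) + E * (8 * Cp * L)) +
          nn * (3 * E))) + C₁p * L * KV + max (Cη 0 1) 0 * E * KV =
          A₁ * L + A₂ * nn + A₃ := by
        rw [hA₁, hA₂, hA₃]; ring
      rw [e]
      have i1 : A₁ * L ≤ A₁ * lam := mul_le_mul_of_nonneg_left hL hA₁0
      have i2 : A₂ * nn ≤ A₂ * lam := mul_le_mul_of_nonneg_left hn hA₂0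
      have i3 : A₃ ≤ A₃ * lam := le_mul_of_one_le_right hA₃0 h1f
      linarith
    have hs0 : 0 ≤ Real.sqrt (amp β a b (S.q + 1)) := Real.sqrt_nonneg _
    have hc0 : 0 < Real.sqrt c₀ := Real.sqrt_pos.2 hc₀
    calc ‖Torus.partialDeriv j (potential ⟨β, α, a, b⟩ S 𝔚 𝒟.cut.η 𝒟.D t) x‖
        ≤ 9 * Real.sqrt (amp β a b (S.q + 1) / c₀) *
            (E * (CV * (9 * E * (2 * (1 + 8 * Cp) * (C₁p * L) + E * (8 * Cp * L)) +
              nn * (3 * E))) + C₁p * L * KV + max (Cη 0 1) 0 * E * KV) := hpt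
      _ ≤ 9 * Real.sqrt (amp β a b (S.q + 1) / c₀) * ((A₁ + A₂ + A₃) * lam) :=
          mul_le_mul_of_nonneg_left hT (by positivity)
      _ = Kd * (Real.sqrt (amp β a b (S.q + 1)) * lam) := by
          rw [hσ, hKd]
          field_simp
      _ ≤ max Ko Kd * (Real.sqrt (amp β a b (S.q + 1)) * freq a b (S.q + 1)) :=
          mul_le_mul_of_nonneg_right (le_max_right _ _) (mul_nonneg hs0 hf1.le)

end PotentialBound

end DeRosa

namespace DeRosa

open BDSV

open FunctionSpaces FunctionSpaces.Torus

/-- The flat three-torus `T³ = (ℝ/ℤ)³`, local notation. -/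
local notation "𝕋³" => UnitAddTorus (Fin 3)

/-- Euclidean `ℝ³`, local notation. -/
local notation "ℝ³" => EuclideanSpace ℝ (Fin 3)

section Assembly

set_option maxHeartbeats 800000 in
/-- **The Nash error estimate holds** (BDSV §6.1.1, arXiv (6.5):
"`‖ℛ(w_{q+1}·∇v̄_q)‖_α ≲ δ_{q+1}^{1/2} δ_q^{1/2} λ_q / λ_{q+1}^{1-α}`", transcribed in
`BDSV.nashErrorEstimate` with the exponent `λ_{q+1}^{-(1-4α)}` of Prop. 6.1 (6.1)): along the common
prefix, the `C^{0,α}` norms of `ℛ((w_{q+1}·∇)v̄_q)` on `[0,T]` are at most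
`C δ_{q+1}^{1/2} δ_q^{1/2} λ_q λ_{q+1}^{-(1-4α)}`. Proof by the Calderón–Zygmund route of the module
docstring: `(w_{q+1}·∇)v̄_q = n_{q+1}⁻¹ div(Z × ∇v̄_q)` (`BDSV.nashSource_eq_smul_tensorDivergence`),
`‖ℛ div G‖_α ≤ C_R ‖G‖_α` (Prop. C.1, `BDSV.holderCZBound_holds`,
`BDSV.holder_antidivergence_tensorDivergence_le`), the product rule and interpolation
(`Torus.eContDiffHolderNorm_crossGradTensor_le`, `Torus.eHolderNorm_le_of_norm_le_of_norm_partialDeriv_le`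
at the scales `λ_{q+1}` for `Z` and `ℓ⁻¹` for `∇v̄_q`), the bounds on `Z` (`BDSV.potentialBound_stageFact`)
and (2.19) at `N = 0, 1`, and arXiv (6.4) `ℓλ_{q+1} ≥ 1`. Thresholds: `α < min(α₀(Z), 1/2, βb(b-1),
(b-1)(1-β)/3)`, `N̄ = max(N̄(Z), 1)`, `a` beyond the thresholds of the bounds on `Z`, of
`2δ_{q+2} ≤ δ_{q+1}λ_q^{-α}` (`ρ_q > 0`) and of (6.4); the constant is
`2π C_R · 18 (3√3+2) · max(C_Z,0) · max(C_in,0)`.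
[cite: BuckmasterEtAl2018, §6.1.1 (arXiv (6.5)) with Prop. 6.1 (6.1)] -/
theorem nashErrorEstimate_holds : nashErrorEstimate := by
  intro 𝔚 c₀ hc₀ Cη β hβ hβ' b hb hb'
  obtain ⟨α₁, hα₁, hP⟩ := potentialBound_stageFact 𝔚 c₀ hc₀ Cη β hβ hβ' b hb hb'
  have hαρ : 0 < β * b * (b - 1) := mul_pos (mul_pos hβ (by linarith)) (by linarith)
  have hα64 : 0 < (b - 1) * (1 - β) / 3 := div_pos (mul_pos (by linarith) (by linarith)) three_pos
  refine ⟨min α₁ (min (min (1 / 2) (β * b * (b - 1))) ((b - 1) * (1 - β) / 3)),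
    lt_min hα₁ (lt_min (lt_min one_half_pos hαρ) hα64), ?_⟩
  intro α hα hαlt
  have hα1' : α < α₁ := lt_of_lt_of_le hαlt (min_le_left _ _)
  have hαr : α < min (min (1 / 2) (β * b * (b - 1))) ((b - 1) * (1 - β) / 3) :=
    lt_of_lt_of_le hαlt (min_le_right _ _)
  have hα1 : α < 1 := by
    have := lt_of_lt_of_le hαr ((min_le_left _ _).trans (min_le_left _ _)); linarith
  have hαρ' : α < 2 * β * b * (b - 1) := by
    have := lt_of_lt_of_le hαr ((min_le_left _ _).trans (min_le_right _ _)); nlinarith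
  have hαb : 3 * α / 2 < (b - 1) * (1 - β) := by
    have := lt_of_lt_of_le hαr (min_le_right _ _); nlinarith
  obtain ⟨N₁, hP⟩ := hP α hα hα1'
  -- the Hölder exponent as an `ℝ≥0` and the Calderón–Zygmund constant
  set r : ℝ≥0 := ⟨α, hα.le⟩ with hr
  have hr0 : 0 < r := hα
  have hr1 : r < 1 := hα1
  have hrα : Real.toNNReal α = r := by
    rw [hr]; exact Real.toNNReal_of_nonneg hα.le
  clear_value r
  obtain ⟨CR, hR⟩ := holder_antidivergence_tensorDivergence_le holderCZBound_holds hr0 hr1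
  refine ⟨max N₁ 1, fun Cin C₀ => ?_⟩
  obtain ⟨C₁, a₁, ha₁, hP⟩ := hP Cin C₀
  obtain ⟨aρ, haρ, hρ⟩ := exists_threshold_amp_succ_succ hb hαρ'
  obtain ⟨a₆, ha₆, h64⟩ := exists_threshold_mollScale_freq_succ hb.le hαb 1
  -- the constants
  have hC₁ : C₁ ≤ max C₁ 0 := le_max_left _ _
  have hCin : Cin ≤ max Cin 0 := le_max_left _ _
  set Cz : ℝ := max C₁ 0 with hCz
  set Cv : ℝ := max Cin 0 with hCv
  have hCz0 : 0 ≤ Cz := le_max_right _ _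
  have hCv0 : 0 ≤ Cv := le_max_right _ _
  set cK : ℝ := Real.sqrt 3 * 3 + 2 with hcK
  have hcK1 : 1 ≤ cK := by
    have := Real.sqrt_nonneg 3; rw [hcK]; nlinarith
  have hcK0 : 0 ≤ cK := zero_le_one.trans hcK1
  clear_value Cz Cv
  refine ⟨2 * Real.pi * (CR : ℝ) * (3 * (2 * (3 * (cK * (Cz * Cv))))), max (max a₁ aρ) a₆,
    lt_max_of_lt_left (lt_max_of_lt_left ha₁), ?_⟩
  intro a ha S H 𝒟
  have ha₁' : a₁ ≤ a := le_trans (le_max_left _ _) (le_trans (le_max_left _ _) ha)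
  have haρ' : aρ ≤ a := le_trans (le_max_right _ _) (le_trans (le_max_left _ _) ha)
  have ha₆' : a₆ ≤ a := le_trans (le_max_right _ _) ha
  have ha1 : (1 : ℝ) ≤ a := le_trans ha₁.le ha₁'
  obtain ⟨eP0, eP1⟩ := hP a ha₁' S (H.of_le (le_max_left _ _)) 𝒟
  have H1 : CoreHypotheses ⟨β, α, a, b⟩ S 1 Cv C₀ :=
    (H.of_le (le_max_right _ _)).mono_const ha1 hCin
  have hsm : SmoothData ⟨β, α, a, b⟩ S 𝒟.cut.η 𝒟.D := H.smoothData ha1 (hρ a haρ' S.q) hc₀ 𝒟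
  have hℓL : 1 ≤ mollScale β α a b S.q * freq a b (S.q + 1) := h64 a ha₆' S.q
  -- the parameters at this stage
  set s : ℝ := Real.sqrt (amp β a b (S.q + 1)) with hs
  set s' : ℝ := Real.sqrt (amp β a b S.q) with hs'
  set lq : ℝ := freq a b S.q with hlq
  set L : ℝ := freq a b (S.q + 1) with hL
  set li : ℝ := (mollScale β α a b S.q)⁻¹ with hli
  have hs0 : 0 ≤ s := Real.sqrt_nonneg _
  have hs'0 : 0 ≤ s' := Real.sqrt_nonneg _
  have hlq0 : 0 < lq := freq_pos ha1 _
  have hL0 : 0 < L := freq_pos ha1 _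
  have hL1 : 1 ≤ L := one_le_freq ha1 _
  have hℓ0 : 0 < mollScale β α a b S.q := mollScale_pos ha1 _
  have hli0 : 0 < li := inv_pos.2 hℓ0
  have hliL : li ≤ L := by
    rw [hli, inv_le_iff_one_le_mul₀ hℓ0, mul_comm]; exact hℓL
  -- `n_{q+1}` and `n_{q+1}⁻¹ = 2π λ_{q+1}⁻¹`
  set n : ℕ := Params.freqNat ⟨β, α, a, b⟩ (S.q + 1) with hn
  have hfreq : L = 2 * Real.pi * (n : ℝ) := by
    rw [hL, hn]
    exact Params.freq_eq ⟨β, α, a, b⟩ (by show (0 : ℝ) ≤ a; linarith) (S.q + 1)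
  have hn0 : (0 : ℝ) < n := by
    have hf := hL0
    rw [hfreq] at hf
    exact pos_of_mul_pos_right hf (by positivity)
  have hninv : ((n : ℝ))⁻¹ = 2 * Real.pi * L⁻¹ := by
    rw [hfreq]
    field_simp
  have hninv0 : 0 ≤ ((n : ℝ))⁻¹ := inv_nonneg.2 hn0.le
  clear_value s s' lq li
  intro t ht
  -- the fields at time `t`
  set Zt : 𝕋³ → ℝ³ := potential ⟨β, α, a, b⟩ S 𝔚 𝒟.cut.η 𝒟.D t with hZt
  set vt : 𝕋³ → ℝ³ := S.vbar t with hvt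
  have hZs : IsSmooth Zt := (hsm.potential 𝔚).isSmooth_slice ht
  have hvs : IsSmooth vt := H.eulerReynolds.smooth_velocity.isSmooth_slice ht
  -- pointwise bounds on `Z`, `∇Z` (with the constant `Cz`) and on `∇v̄`, `∇²v̄` ((2.19) at
  -- `N = 0, 1`, with the constant `Cv`), as `ℝ≥0` numbers
  set z₀ : ℝ≥0 := ⟨Cz * s, mul_nonneg hCz0 hs0⟩ with hz₀
  set z₁ : ℝ≥0 := ⟨Cz * s * L, by positivity⟩ with hz₁
  set g₀ : ℝ≥0 := ⟨Cv * s' * lq, by positivity⟩ with hg₀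
  set g₁ : ℝ≥0 := ⟨Cv * s' * lq * li, by positivity⟩ with hg₁
  have hz0 : ∀ x, ‖Zt x‖ ≤ (z₀ : ℝ) := fun x =>
    (eP0 t ht x).trans (mul_le_mul_of_nonneg_right hC₁ hs0)
  have hz1 : ∀ i x, ‖Torus.partialDeriv i Zt x‖ ≤ (z₁ : ℝ) := fun i x => by
    refine (eP1 i t ht x).trans ?_
    show C₁ * (s * L) ≤ Cz * s * L
    nlinarith [mul_nonneg hs0 hL0.le]
  have hv1 := H1.velocity 0 (Nat.zero_le _) t ht
  have hv2 := H1.velocity 1 le_rfl t ht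
  simp only [Nat.cast_zero, neg_zero, Real.rpow_zero, mul_one, zero_add] at hv1
  simp only [Nat.cast_one, Real.rpow_neg_one, Nat.reduceAdd] at hv2
  rw [← hvt, ← hs', ← hlq] at hv1
  rw [← hvt, ← hs', ← hlq, ← hli] at hv2
  have hg0 : ∀ c x, ‖Torus.partialDeriv c vt x‖ ≤ (g₀ : ℝ) := fun c x => by
    have h := norm_partialDeriv_le_of_eContDiffHolderNorm_le (hvs.isContDiff (by simp))
      (mul_nonneg hCv0 (mul_nonneg hs'0 hlq0.le)) hv1 c x
    refine h.trans (le_of_eq ?_)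
    show Cv * (s' * lq) = Cv * s' * lq
    ring
  have hg1 : ∀ i c x, ‖Torus.partialDeriv i (Torus.partialDeriv c vt) x‖ ≤ (g₁ : ℝ) := fun i c x => by
    have h := norm_partialDeriv_partialDeriv_le_of_eContDiffHolderNorm_le hvs
      (mul_nonneg hCv0 (mul_nonneg (mul_nonneg hs'0 hlq0.le) hli0.le)) hv2 i c x
    refine h.trans (le_of_eq ?_)
    show Cv * (s' * lq * li) = Cv * s' * lq * li
    ring
  -- interpolation at the scales `Λ = λ_{q+1}` (for `Z`) and `Λ = ℓ⁻¹` (for `∇v̄`)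
  set ΛZ : ℝ≥0 := ⟨L, hL0.le⟩ with hΛZ
  have hΛZ0 : 0 < ΛZ := hL0
  set Λg : ℝ≥0 := ⟨li, hli0.le⟩ with hΛg
  have hΛg0 : 0 < Λg := hli0
  have hHz := eHolderNorm_le_of_norm_le_of_norm_partialDeriv_le (hZs.isContDiff (by simp)) hr1.le hΛZ0
    hz0 hz1
  have hHg : ∀ c, eHolderNorm r (Torus.partialDeriv c vt) ≤ _ := fun c =>
    eHolderNorm_le_of_norm_le_of_norm_partialDeriv_le ((hvs.partialDeriv c).isContDiff (by simp)) hr1.le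
      hΛg0 (hg0 c) (fun i x => hg1 i c x)
  rw [Fintype.card_fin] at hHz hHg
  set Hz : ℝ≥0 := NNReal.sqrt (3 : ℕ) * ((3 : ℕ) * z₁) * ΛZ⁻¹ ^ (1 - r : ℝ) + 2 * z₀ * ΛZ ^ (r : ℝ) with hHzdef
  set Hg : ℝ≥0 := NNReal.sqrt (3 : ℕ) * ((3 : ℕ) * g₁) * Λg⁻¹ ^ (1 - r : ℝ) + 2 * g₀ * Λg ^ (r : ℝ) with hHgdef
  -- the values of the four Hölder data as real numbers
  have hrR : ((r : ℝ≥0) : ℝ) = α := by rw [hr]; rfl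
  have hz₀R : (z₀ : ℝ) = Cz * s := rfl
  have hz₁R : (z₁ : ℝ) = Cz * s * L := rfl
  have hg₀R : (g₀ : ℝ) = Cv * s' * lq := rfl
  have hg₁R : (g₁ : ℝ) = Cv * s' * lq * li := rfl
  have hΛZR : (ΛZ : ℝ) = L := rfl
  have hΛgR : (Λg : ℝ) = li := rfl
  have hHzR : (Hz : ℝ) = (Real.sqrt 3 * 3 + 2) * (Cz * s) * L ^ α := by
    rw [hHzdef, ← interp_scale_eq (M := Cz * s) (α := α) hL0]
    push_cast
    rw [hz₀R, hz₁R, hΛZR, hrR]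
  have hHgR : (Hg : ℝ) = (Real.sqrt 3 * 3 + 2) * (Cv * s' * lq) * li ^ α := by
    rw [hHgdef, ← interp_scale_eq (M := Cv * s' * lq) (α := α) hli0]
    push_cast
    rw [hg₀R, hg₁R, hΛgR, hrR]
  -- the tensor and `ℛ div`
  have hT := eContDiffHolderNorm_crossGradTensor_le hZs hvs r hz0 hg0 hHz hHg
  have hGs : IsSmooth (crossGradTensor Zt vt) := isSmooth_crossGradTensor hZs hvs
  have hRt := hR (crossGradTensor Zt vt) hGs
  have hdivs : IsSmooth (Torus.tensorDivergence (crossGradTensor Zt vt)) := hGs.tensorDivergence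
  have hanti : IsSmooth (Torus.antidivergence (Torus.tensorDivergence (crossGradTensor Zt vt))) :=
    Torus.isSmooth_antidivergence hdivs
  have hfin : Torus.eContDiffHolderNorm 0 r
      (Torus.antidivergence (Torus.tensorDivergence (crossGradTensor Zt vt))) ≤
      ((CR * (3 * (2 * (z₀ * (g₀ + Hg) + Hz * g₀))) : ℝ≥0) : ℝ≥0∞) := by
    refine (hRt.trans (mul_le_mul_of_nonneg_left hT bot_le)).trans (le_of_eq ?_)
    push_cast
    ring
  -- the Nash term
  have hN : nashSource ⟨β, α, a, b⟩ S 𝔚 𝒟.cut.η 𝒟.D t =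
      ((n : ℝ))⁻¹ • Torus.tensorDivergence (crossGradTensor Zt vt) := by
    funext x
    exact nashSource_eq_smul_tensorDivergence 𝔚 hZs hvs x
  -- assemble in `ℝ≥0∞`
  rw [hrα]
  show Torus.eContDiffHolderNorm 0 r
      (Torus.antidivergence (nashSource ⟨β, α, a, b⟩ S 𝔚 𝒟.cut.η 𝒟.D t)) ≤ _
  rw [hN, Torus.antidivergence_const_smul hdivs, Torus.eContDiffHolderNorm_const_smul (hanti.isContDiff (by simp)),
    Real.enorm_eq_ofReal hninv0]
  calc ENNReal.ofReal ((n : ℝ))⁻¹ *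
        Torus.eContDiffHolderNorm 0 r (Torus.antidivergence (Torus.tensorDivergence (crossGradTensor Zt vt)))
      ≤ ENNReal.ofReal ((n : ℝ))⁻¹ * ((CR * (3 * (2 * (z₀ * (g₀ + Hg) + Hz * g₀))) : ℝ≥0) : ℝ≥0∞) :=
        mul_le_mul_of_nonneg_left hfin bot_le
    _ = ENNReal.ofReal (((n : ℝ))⁻¹ * ((CR * (3 * (2 * (z₀ * (g₀ + Hg) + Hz * g₀))) : ℝ≥0))) := by
        rw [← ENNReal.ofReal_coe_nnreal, ← ENNReal.ofReal_mul hninv0]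
    _ ≤ _ := ENNReal.ofReal_le_ofReal ?_
  -- the real inequality
  rw [hninv]
  push_cast
  rw [hz₀R, hg₀R, hHzR, hHgR]
  have hliα : li ^ α ≤ L ^ α := Real.rpow_le_rpow hli0.le hliL hα.le
  refine nash_arith hs0 hs'0 hlq0.le hL1 hα.le hcK1 hCz0 hCv0 (NNReal.coe_nonneg CR)
    (by positivity) (by positivity) le_rfl le_rfl (le_of_eq (by rw [hcK]; ring)) ?_
  calc (Real.sqrt 3 * 3 + 2) * (Cv * s' * lq) * li ^ α
      ≤ (Real.sqrt 3 * 3 + 2) * (Cv * s' * lq) * L ^ α :=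
        mul_le_mul_of_nonneg_left hliα (by positivity)
    _ = cK * Cv * s' * lq * L ^ α := by rw [hcK]; ring

end Assembly

end DeRosa

/-! ## Port of `OnsagerBDSVOscillationPrincipalDiv` -/

namespace DeRosa

open BDSV

open FunctionSpaces FunctionSpaces.Torus

/-- The flat three-torus `T³ = (ℝ/ℤ)³`, local notation. -/
local notation "𝕋³" => UnitAddTorus (Fin 3)

/-- Euclidean `ℝ³`, local notation. -/
local notation "ℝ³" => EuclideanSpace ℝ (Fin 3)

/-- Real `3 × 3` matrices, local notation. -/
local notation "𝕄" => Matrix (Fin 3) (Fin 3) ℝ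

section SlowDiv

variable (P : Params) (S : Setting)

variable {P S}

variable {Nbar : ℕ} {Cin C₀ c₀ : ℝ} {Cη : ℕ → ℕ → ℝ}

/-- The columns of the `i`-th conjugated mean-free Mikado tensor form a smooth tensor field at each
time of `[0,T]` (under the standing hypotheses with `c₀ > 0`, `ρ_q > 0`). [folklore] -/
theorem PerturbationData.isSmooth_principalOscCols (H : CoreHypotheses P S Nbar Cin C₀)
    (𝒟 : PerturbationData P S c₀ Cη) (𝔚 : MikadoDatum mikadoRadius) (hc₀ : 0 < c₀)
    (hρ : ∀ s ∈ Icc 0 S.T, 0 < rhoQ P S s) (i : ℕ) {t : ℝ} (ht : t ∈ Icc 0 S.T) :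
    IsSmooth (fun y j => colsOf (principalOscMatrix P S 𝔚 𝒟.cut.η 𝒟.D i t y) j) := by
  have hSD : SmoothData P S 𝒟.cut.η 𝒟.D := H.toSmoothData hc₀ 𝒟 hρ
  have hρs : IsSmooth (rhoI P S 𝒟.cut.η i t) := (hSD.rhoI i).isSmooth_slice ht
  have hRt : IsSmooth fun y => tildeR P S 𝒟.cut.η 𝒟.D i t y :=
    𝒟.isSmooth_tildeR H (fun s hs => (hρ s hs).ne') i ht
  have hDt : IsSmooth (𝒟.D i t) := (𝒟.flow i).smooth.isSmooth_slice ht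
  refine contDiff_pi.2 fun j => contDiff_euclidean.2 fun a' => ?_
  have heq : (fun y => colsOf (principalOscMatrix P S 𝔚 𝒟.cut.η 𝒟.D i t y) j a') = fun y =>
      ∑ c, ∑ d, oscAmp P S 𝒟.cut.η 𝒟.D i t a' j c d y *
        phaseComp (𝔚.fluctFam c d) (fun z => tildeR P S 𝒟.cut.η 𝒟.D i t z) (𝒟.D i t)
          (P.freqNat (S.q + 1)) y := by
    funext y
    rw [colsOf_apply, principalOscMatrix_apply]
  have h := Torus.isSmooth_finset_sum (Finset.univ : Finset (Fin 3)) (f := fun c y => ∑ d,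
    oscAmp P S 𝒟.cut.η 𝒟.D i t a' j c d y *
      phaseComp (𝔚.fluctFam c d) (fun z => tildeR P S 𝒟.cut.η 𝒟.D i t z) (𝒟.D i t) (P.freqNat (S.q + 1)) y)
    fun c _ => Torus.isSmooth_finset_sum _ fun d _ =>
      ((hρs.mul (isSmooth_adjugate_jac_entry hDt a' c)).mul (isSmooth_adjugate_jac_entry hDt j d)).mul
        ((𝔚.jointSmooth_fluctFam c d).phaseComp hRt hDt _)
  have h' : IsSmooth (fun y => colsOf (principalOscMatrix P S 𝔚 𝒟.cut.η 𝒟.D i t y) j a') := by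
    rw [heq]; exact h
  exact h'

/-- **The slow-divergence identity** (BDSV §6.1.3: with (6.10) and "(5.7)
`∇Φ_i⁻¹C_k∇Φ_i⁻ᵀ∇Φ_iᵀ k = 0`, consequently
`div(Σ_i w_{o,i} ⊗ w_{o,i} - R_{q,i}) = Σ_{i,k≠0} div(ρ_{q,i}∇Φ_i⁻¹C_k(R̃_{q,i})∇Φ_i⁻ᵀ) e^{iλ_{q+1}k·Φ_i}`",
i.e. only slow derivatives survive): under the standing hypotheses with `a ≥ 1`, `c₀ > 0`, `ρ_q > 0`
on `[0,T]`, at a time `t ∈ [0,T]` at which `R̃_{q,i}(t,·)` takes values in the Mikado ball (an active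
time, Lemma 5.4), the divergence of the `i`-th conjugated mean-free Mikado tensor
`ρ_{q,i} adj∇Φ_i 𝕎(R̃_{q,i}, n_{q+1}Φ_i) adj∇Φ_iᵀ` is the slow divergence `BDSV.oscSlowDiv`:
the fast derivative `n ρ_i Σ_c A_{a'c} (div_ξ 𝕎)_c(R̃, nΦ)` vanishes (`∇Φ adj∇Φ = I`, `div_ξ 𝕎 = 0`).
[cite: BuckmasterEtAl2018, §6.1.3 (arXiv (6.10) and the display after it)] -/
theorem PerturbationData.tensorDivergence_principalOscMatrix_eq (H : CoreHypotheses P S Nbar Cin C₀)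
    (𝒟 : PerturbationData P S c₀ Cη) (𝔚 : MikadoDatum mikadoRadius) (ha : 1 ≤ P.a) (hc₀ : 0 < c₀)
    (hρ : ∀ s ∈ Icc 0 S.T, 0 < rhoQ P S s) {i : ℕ} {t : ℝ} (ht : t ∈ Icc 0 S.T)
    (hball : ∀ y, tildeR P S 𝒟.cut.η 𝒟.D i t y ∈ Metric.closedBall (1 : 𝕄) mikadoRadius) (x : 𝕋³) :
    Torus.tensorDivergence (fun y j => colsOf (principalOscMatrix P S 𝔚 𝒟.cut.η 𝒟.D i t y) j) x =
      ∑ a', oscSlowDiv P S 𝔚 𝒟.cut.η 𝒟.D i t a' x • EuclideanSpace.single a' (1 : ℝ) := by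
  -- smoothness of the players at time `t`
  have hSD : SmoothData P S 𝒟.cut.η 𝒟.D := H.toSmoothData hc₀ 𝒟 hρ
  have hρs : IsSmooth (rhoI P S 𝒟.cut.η i t) := (hSD.rhoI i).isSmooth_slice ht
  have hRt : IsSmooth fun y => tildeR P S 𝒟.cut.η 𝒟.D i t y :=
    𝒟.isSmooth_tildeR H (fun s hs => (hρ s hs).ne') i ht
  have hDt : IsSmooth (𝒟.D i t) := (𝒟.flow i).smooth.isSmooth_slice ht
  have hdet : ∀ y, (jac (𝒟.D i t) y).det = 1 := fun y => 𝒟.det_gradPhi_eq_one H ha i ht y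
  have hsym : ∀ y, (tildeR P S 𝒟.cut.η 𝒟.D i t y).IsSymm := fun y =>
    isSymm_tildeR (fun p q => H.eulerReynolds.symm t ht y p q) i
  set n : ℕ := P.freqNat (S.q + 1) with hndef
  -- `G = G̃` along the frame (as functions of `y`)
  have hGeq : ∀ c d, phaseComp (𝔚.fluctFam c d) (fun y => tildeR P S 𝒟.cut.η 𝒟.D i t y) (𝒟.D i t) n =
      phaseComp (𝔚.fluctZ c d) (fun y => tildeR P S 𝒟.cut.η 𝒟.D i t y) (𝒟.D i t) n := by
    intro c d
    funext y
    unfold phaseComp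
    exact (𝔚.fluctZ_eq_of_mem c d (hball y) (hsym y) _).symm
  -- `div_ξ G̃ = 0` along the frame
  have hdiv : ∀ c, ∑ d, phaseComp (dXi d (𝔚.fluctZ c d)) (fun y => tildeR P S 𝒟.cut.η 𝒟.D i t y)
      (𝒟.D i t) n x = 0 := by
    intro c
    unfold phaseComp
    simp only [𝔚.dXi_fluctZ]
    exact 𝔚.sum_dXi_fluctFam_eq_zero (hball x) (hsym x) c _
  have hS := 𝒟.isSmooth_principalOscCols H 𝔚 hc₀ hρ i ht
  -- componentwise: `v = Σ_{a'} v_{a'} e_{a'}`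
  have hbasis : ∀ v : ℝ³, v = ∑ a', v a' • EuclideanSpace.single a' (1 : ℝ) := by
    intro v
    conv_lhs => rw [← (EuclideanSpace.basisFun (Fin 3) ℝ).sum_repr v]
    simp [EuclideanSpace.basisFun_apply]
  refine (hbasis _).trans (Finset.sum_congr rfl fun a' _ => ?_)
  congr 1
  rw [Torus.tensorDivergence, WithLp.ofLp_sum, Finset.sum_apply]
  have hcomp : ∀ j, (WithLp.ofLp (Torus.partialDeriv j
      (fun y => colsOf (principalOscMatrix P S 𝔚 𝒟.cut.η 𝒟.D i t y) j) x)) a' =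
      Torus.partialDeriv j (fun y => ∑ c, ∑ d, oscAmp P S 𝒟.cut.η 𝒟.D i t a' j c d y *
        phaseComp (𝔚.fluctZ c d) (fun z => tildeR P S 𝒟.cut.η 𝒟.D i t z) (𝒟.D i t) n y) x := by
    intro j
    rw [show (WithLp.ofLp (Torus.partialDeriv j
        (fun y => colsOf (principalOscMatrix P S 𝔚 𝒟.cut.η 𝒟.D i t y) j) x)) a' =
        Torus.partialDeriv j (fun y => colsOf (principalOscMatrix P S 𝔚 𝒟.cut.η 𝒟.D i t y) j) x a' from rfl,
      partialDeriv_apply_eq (hS.column j) j a' x]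
    congr 1
    funext y
    rw [colsOf_apply, principalOscMatrix_apply, ← hndef]
    simp only [hGeq]
  simp only [hcomp]
  have key := sum_partialDeriv_conjComposite_eq (w := fun c d => 𝔚.fluctZ c d) (ρ := rhoI P S 𝒟.cut.η i t)
    (fun c d => 𝔚.jointSmooth_fluctZ c d) hRt hDt hρs n (hdet x) hdiv a'
  simp only [oscAmp, oscSlowDiv]
  exact key

end SlowDiv

end DeRosa

/-! ## Port of `OnsagerBDSVOscillationSplitProofs` -/

namespace DeRosa

open BDSV

/-- **The corrector oscillation term `𝒪₂` is bounded as printed** (BDSV §6.1.3, arXiv (6.9):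
"`‖𝒪₂‖_α ≲ ‖w_o‖₀‖w_c‖_α + ‖w_o‖_α‖w_c‖₀ + ‖w_c‖_α² ≲ δ_{q+1}/(ℓλ_{q+1}^{1-α})
≲ δ_{q+1}^{1/2}δ_q^{1/2}λ_q/λ_{q+1}^{1-α}`"): the named fact `BDSV.oscillationCorrectorEstimate` —
along the common prefix, the `C^{0,α}` norms of `𝒪₂ = ℛ div(w_o ⊗ w_c + w_c ⊗ w_o + w_c ⊗ w_c)` on
`[0,T]` are at most `C δ_{q+1}^{1/2} δ_q^{1/2} λ_q λ_{q+1}^{-(1-4α)}` — holds: the conditional proof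
`BDSV.oscillationCorrectorEstimate_of_bounds` (Prop. C.1 for `ℛ div`, the product rule and
interpolation, the scale comparison of (6.9) and the threshold `ℓλ_{q+1} ≥ 1` of arXiv (6.4)) applied
to the discharges of Prop. C.1 (`BDSV.holderCZBound_holds`) and of Cor. 5.8
(`BDSV.principalPartBound_holds`, `BDSV.correctorPartBound_holds`).
[cite: BuckmasterEtAl2018, §6.1.3 (arXiv (6.9)) with Cor. 5.8 (arXiv (5.29)–(5.30)) and Prop. C.1] -/
theorem oscillationCorrectorEstimate_holds : oscillationCorrectorEstimate :=
  oscillationCorrectorEstimate_of_bounds holderCZBound_holds principalPartBound_holds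
    correctorPartBound_holds

end DeRosa

/-! ## Port of `OnsagerBDSVOscillationPrincipalProofs` -/

namespace DeRosa

open BDSV

open FunctionSpaces FunctionSpaces.Torus

/-- The flat three-torus `T³ = (ℝ/ℤ)³`, local notation. -/
local notation "𝕋³" => UnitAddTorus (Fin 3)

/-- Euclidean `ℝ³`, local notation. -/
local notation "ℝ³" => EuclideanSpace ℝ (Fin 3)

/-- Real `3 × 3` matrices, local notation. -/
local notation "𝕄" => Matrix (Fin 3) (Fin 3) ℝ

section CutoffSum

variable {P : Params} {S : Setting} {Nbar : ℕ} {Cin C₀ c₀ : ℝ} {Cη : ℕ → ℕ → ℝ}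

/-- **`𝒪₁ = Σ_i ℛ div(ρ_{q,i} A 𝕎(R̃_{q,i}, n_{q+1}Φ_i) Aᵀ)`** on `[0,T]`: (6.10) summed over the cut-offs
(`BDSV.PerturbationData.oscPrincipalTensor_eq_sum`) and the linearity of `div` and `ℛ` on smooth fields.
[cite: BuckmasterEtAl2018, §6.1.3 (arXiv (6.10))] -/
theorem PerturbationData.antidivergence_oscPrincipalSource_eq_sum (H : CoreHypotheses P S Nbar Cin C₀)
    (𝒟 : PerturbationData P S c₀ Cη) (𝔚 : MikadoDatum mikadoRadius) (ha : 1 ≤ P.a) (hc₀ : 0 < c₀)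
    (hρ : ∀ s ∈ Icc 0 S.T, 0 < rhoQ P S s) {t : ℝ} (ht : t ∈ Icc 0 S.T) :
    Torus.antidivergence (oscPrincipalSource P S 𝔚 𝒟.cut.η 𝒟.D t) =
      ∑ i ∈ Finset.range (cutoffCount S.T (P.τ S.q)), Torus.antidivergence
        (Torus.tensorDivergence fun y j => colsOf (principalOscMatrix P S 𝔚 𝒟.cut.η 𝒟.D i t y) j) := by
  have hSi : ∀ i, IsSmooth (fun y j => colsOf (principalOscMatrix P S 𝔚 𝒟.cut.η 𝒟.D i t y) j) := fun i =>
    𝒟.isSmooth_principalOscCols H 𝔚 hc₀ hρ i ht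
  have hdiv : ∀ i, IsSmooth (Torus.tensorDivergence fun y j =>
      colsOf (principalOscMatrix P S 𝔚 𝒟.cut.η 𝒟.D i t y) j) := fun i =>
    Torus.isSmooth_finset_sum Finset.univ fun l _ => ((hSi i).column l).partialDeriv l
  have hT : oscPrincipalTensor P S 𝔚 𝒟.cut.η 𝒟.D t = ∑ i ∈ Finset.range (cutoffCount S.T (P.τ S.q)),
      (fun y j => colsOf (principalOscMatrix P S 𝔚 𝒟.cut.η 𝒟.D i t y) j) := by
    funext y j
    rw [Finset.sum_apply, Finset.sum_apply]
    exact 𝒟.oscPrincipalTensor_eq_sum H ha hc₀ hρ 𝔚 ht y j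
  have hsrc : oscPrincipalSource P S 𝔚 𝒟.cut.η 𝒟.D t = ∑ i ∈ Finset.range (cutoffCount S.T (P.τ S.q)),
      Torus.tensorDivergence (fun y j => colsOf (principalOscMatrix P S 𝔚 𝒟.cut.η 𝒟.D i t y) j) := by
    funext x
    rw [Finset.sum_apply]
    show Torus.tensorDivergence (oscPrincipalTensor P S 𝔚 𝒟.cut.η 𝒟.D t) x = _
    rw [hT]
    exact tensorDivergence_finset_sum _ (fun i _ => hSi i) x
  rw [hsrc]
  exact antidivergence_finset_sum _ fun i _ => hdiv i

end CutoffSum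

section TermBound

variable {P : Params} {S : Setting} {Nbar : ℕ} {Cin C₀ c₀ : ℝ} {Cη : ℕ → ℕ → ℝ}

/-- **Scaled bounds on `ρ_{q,i}(t,·)`** at order `K+2`: `‖ρ_{q,i}‖_{C^k} ≤ c Cη'² (δ_{q+1}/c₀) ℓ^{-k}`,
`c = leibConst (K+1)`, `Cη' = Σ_{k≤K+2}|C_η(0,k)|` (Lemma 5.3 for `η_i`, `ρ_q ≤ δ_{q+1}`, `Σ∫η² ≥ c₀`).
[cite: BuckmasterEtAl2018, Lemma 5.3 and §5.2 (ρ_{q,i})] -/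
theorem PerturbationData.scaledBound_rhoI (H : CoreHypotheses P S Nbar Cin C₀)
    (𝒟 : PerturbationData P S c₀ Cη) (hc₀ : 0 < c₀) (ha : 1 ≤ P.a) (hb : 1 ≤ P.b) (hβ : 0 ≤ P.β)
    (hα : 0 ≤ P.α) (hρ : ∀ s ∈ Icc 0 S.T, 0 < rhoQ P S s) (K : ℕ) (i : ℕ) {t : ℝ} (ht : t ∈ Icc 0 S.T) :
    ScaledBound (rhoI P S 𝒟.cut.η i t) (K + 2) (mollScale P.β P.α P.a P.b S.q)
      (leibConst (K + 1) * (∑ k ∈ Finset.range (K + 3), |Cη 0 k|) ^ 2 * (amp P.β P.a P.b (S.q + 1) / c₀)) := by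
  set ℓ := mollScale P.β P.α P.a P.b S.q with hℓdef
  set Cη' : ℝ := ∑ k ∈ Finset.range (K + 3), |Cη 0 k| with hCη'
  set c : ℝ := leibConst (K + 1) with hcdef
  set δ := amp P.β P.a P.b (S.q + 1) with hδdef
  have hℓ : 0 < ℓ := mollScale_pos ha _
  have hli : 1 ≤ ℓ⁻¹ := one_le_mollScale_inv ha hb hβ hα _
  have hδ : 0 < δ := amp_pos ha _
  have hCη'0 : 0 ≤ Cη' := Finset.sum_nonneg fun k _ => abs_nonneg _
  set sc : ℝ := rhoQ P S t / etaMass P S 𝒟.cut.η t with hscdef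
  have hsc0 : 0 ≤ sc := div_nonneg (hρ t ht).le (hc₀.le.trans (𝒟.le_etaMass ht))
  have hsc : sc ≤ δ / c₀ := div_le_div₀ hδ.le (H.rhoQ_le ha ht) hc₀ (𝒟.le_etaMass ht)
  have hηs : IsSmooth (𝒟.cut.η i t) := (𝒟.cut.smooth i).isSmooth_slice ht
  have hηB : ScaledBound (𝒟.cut.η i t) (K + 2) ℓ Cη' := by
    intro k hk
    have h := 𝒟.cut.deriv_le i 0 k t ht
    simp only [Function.iterate_zero, id_eq, Nat.cast_zero, neg_zero, Real.rpow_zero, mul_one] at h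
    refine h.trans (ENNReal.ofReal_le_ofReal ?_)
    have h1 : Cη 0 k ≤ Cη' := (le_abs_self _).trans
      (Finset.single_le_sum (f := fun k => |Cη 0 k|) (fun _ _ => abs_nonneg _)
        (Finset.mem_range.2 (by omega)))
    exact h1.trans (le_mul_of_one_le_right hCη'0 (one_le_pow₀ hli))
  have e : rhoI P S 𝒟.cut.η i t = fun x => sc * (𝒟.cut.η i t x * 𝒟.cut.η i t x) := by
    funext x
    rw [rhoI, hscdef]
    ring
  have h := ((hηB.mul hηB hηs hηs hCη'0 hCη'0 hℓ).const_mul (hηs.mul hηs) sc)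
  rw [e]
  refine h.mono_M ?_ hℓ
  rw [abs_of_nonneg hsc0]
  have hl := leib_le (N := K + 2) (K₀ := K + 1) (by omega)
  push_cast at hl ⊢
  have h1 : (3 : ℝ) ^ (K + 2) * (K + 2 + 1) * Cη' * Cη' ≤ c * Cη' ^ 2 := by
    rw [pow_two, ← mul_assoc]
    exact mul_le_mul_of_nonneg_right (mul_le_mul_of_nonneg_right hl hCη'0) hCη'0
  calc sc * ((3 : ℝ) ^ (K + 2) * (K + 2 + 1) * Cη' * Cη') ≤ (δ / c₀) * (c * Cη' ^ 2) :=
        mul_le_mul hsc h1 (by positivity) (by positivity)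
    _ = c * Cη' ^ 2 * (δ / c₀) := by ring

/-- **Scaled bounds on the conjugation amplitudes** `ρ_{q,i} A_{a'c} A_{jd}` at order `K+2` in a
phase frame of level `K+2`: `≤ c³ Λ² Cη'² (δ_{q+1}/c₀) ℓ^{-k}`. [cite: BuckmasterEtAl2018, Prop. 5.7 and Lemma 5.3] -/
theorem PerturbationData.scaledBound_oscAmp (H : CoreHypotheses P S Nbar Cin C₀)
    (𝒟 : PerturbationData P S c₀ Cη) (hc₀ : 0 < c₀) (ha : 1 ≤ P.a) (hb : 1 ≤ P.b) (hβ : 0 ≤ P.β)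
    (hα : 0 ≤ P.α) (hρ : ∀ s ∈ Icc 0 S.T, 0 < rhoQ P S s) {K : ℕ} {i : ℕ} {t : ℝ} (ht : t ∈ Icc 0 S.T)
    {Λ : ℝ} {Kset : Set 𝕄}
    (hP : PhaseFrame (fun x => tildeR P S 𝒟.cut.η 𝒟.D i t x) (𝒟.D i t) (P.freqNat (S.q + 1)) (K + 2)
      (mollScale P.β P.α P.a P.b S.q) Λ Kset) (a' j c' d : Fin 3) :
    ScaledBound (oscAmp P S 𝒟.cut.η 𝒟.D i t a' j c' d) (K + 2) (mollScale P.β P.α P.a P.b S.q)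
      (leibConst (K + 1) ^ 3 * Λ ^ 2 * (∑ k ∈ Finset.range (K + 3), |Cη 0 k|) ^ 2 *
        (amp P.β P.a P.b (S.q + 1) / c₀)) := by
  set ℓ := mollScale P.β P.α P.a P.b S.q with hℓdef
  set Cη' : ℝ := ∑ k ∈ Finset.range (K + 3), |Cη 0 k| with hCη'
  set c : ℝ := leibConst (K + 1) with hcdef
  set δ := amp P.β P.a P.b (S.q + 1) with hδdef
  have hℓ : 0 < ℓ := mollScale_pos ha _
  have hδ : 0 < δ := amp_pos ha _
  have hc0 : 0 ≤ c := zero_le_one.trans (one_le_leibConst (K + 1))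
  have hΛ0 : 0 ≤ Λ := zero_le_one.trans hP.one_le_Λ
  have hρB := 𝒟.scaledBound_rhoI H hc₀ ha hb hβ hα hρ K i ht
  have hρs : IsSmooth (rhoI P S 𝒟.cut.η i t) := by
    have hηs : IsSmooth (𝒟.cut.η i t) := (𝒟.cut.smooth i).isSmooth_slice ht
    have e : rhoI P S 𝒟.cut.η i t = fun x => 𝒟.cut.η i t x ^ 2 * (rhoQ P S t / etaMass P S 𝒟.cut.η t) := rfl
    rw [e]
    exact (hηs.pow 2).mul (isSmooth_const _)
  have hA : ∀ m j, IsSmooth fun x => (jac (𝒟.D i t) x).adjugate m j := fun m j =>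
    isSmooth_adjugate_jac_entry hP.smooth_D m j
  have hM₀ : 0 ≤ c * Cη' ^ 2 * (δ / c₀) := by positivity
  have hl := leib_le (N := K + 2) (K₀ := K + 1) (by omega)
  push_cast at hl
  have h1 := hρB.mul (hP.adj_bound a' c') hρs (hA a' c') hM₀ hΛ0 hℓ
  have h1' : ScaledBound (fun x => rhoI P S 𝒟.cut.η i t x * (jac (𝒟.D i t) x).adjugate a' c') (K + 2) ℓ
      (c * (c * Cη' ^ 2 * (δ / c₀)) * Λ) := by
    refine h1.mono_M ?_ hℓ
    push_cast
    exact mul_le_mul_of_nonneg_right (mul_le_mul_of_nonneg_right hl hM₀) hΛ0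
  have hM₁ : 0 ≤ c * (c * Cη' ^ 2 * (δ / c₀)) * Λ := by positivity
  have h2 := h1'.mul (hP.adj_bound j d) (hρs.mul (hA a' c')) (hA j d) hM₁ hΛ0 hℓ
  refine h2.mono_M ?_ hℓ
  push_cast
  calc (3 : ℝ) ^ (K + 2) * (K + 2 + 1) * (c * (c * Cη' ^ 2 * (δ / c₀)) * Λ) * Λ
      ≤ c * (c * (c * Cη' ^ 2 * (δ / c₀)) * Λ) * Λ :=
        mul_le_mul_of_nonneg_right (mul_le_mul_of_nonneg_right hl hM₁) hΛ0
    _ = c ^ 3 * Λ ^ 2 * Cη' ^ 2 * (δ / c₀) := by ring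

/-- **The bound on the `i`-th conjugated tensor at an active time** (the heart of (6.11)): in the
phase frame of the construction at level `K+2` (Prop. 5.7 for `∇Φ_i`, `adj∇Φ_i`, `R̃_{q,i}`; Lemma 5.4
for `R̃_{q,i} ∈ B̄(Id, 1/10)`), with `nℓ ≥ 1`, operator constants `C_d, C_r` (Prop. C.1) and one
level-`K` bound family `U` for the fluctuation profiles, the slow-divergence identity and the composite
stationary-phase bound for `ℛ` give
`‖ℛ div(ρ_{q,i} A 𝕎(R̃_{q,i}, nΦ_i) Aᵀ)‖_{C^{0,r}} ≤ 810 F U (a_K n^{-(1-r)} + b_K n^r (nℓ)^{-K})`,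
`F = c⁴ Λ³ Cη'² (δ_{q+1}/c₀) ℓ⁻¹`, `c = leibConst (K+1)`, `Cη' = Σ_{k ≤ K+2}|C_η(0,k)|` — i.e.
"`‖𝒪₁‖_α ≲ Σ_i Σ_{k≠0} ‖div(ρ_{q,i}∇Φ_i⁻¹C_k∇Φ_i⁻ᵀ)‖₀/λ_{q+1}^{1-α} + … ≲ δ_{q+1}/(ℓλ_{q+1}^{1-α}) + [absorbed]`".
[cite: BuckmasterEtAl2018, §6.1.3 (arXiv (6.11))] -/
theorem PerturbationData.holder_antidivergence_principalOsc_le (H : CoreHypotheses P S Nbar Cin C₀)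
    (𝒟 : PerturbationData P S c₀ Cη) (𝔚 : MikadoDatum mikadoRadius) (hc₀ : 0 < c₀) (hCin : 0 ≤ Cin)
    (ha : 1 ≤ P.a) (hb : 1 ≤ P.b) (hβ : 0 ≤ P.β) (hα : 0 ≤ P.α)
    (h4 : 4 * amp P.β P.a P.b (S.q + 2) ≤ amp P.β P.a P.b (S.q + 1) * freq P.a P.b S.q ^ (-P.α))
    (hdef : Real.exp (4 * (Cin * mollScale P.β P.α P.a P.b S.q ^ (2 * P.α))) - 1 ≤ 1 / 300)
    (hstr : 8 * (Cin * (freq P.a P.b S.q ^ P.α * mollScale P.β P.α P.a P.b S.q ^ P.α)) ≤ 1 / 100)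
    {K : ℕ} (hK : K + 2 ≤ Nbar) {CJ : ℝ} (hCJ : 0 ≤ CJ) {i : ℕ} {t : ℝ} (ht : t ∈ Icc 0 S.T)
    (hJ : ∀ k ≤ K + 2, Torus.eContDiffHolderNorm k 0 (fun x => gradPhi 𝒟.D i t x) ≤
      ENNReal.ofReal (CJ * mollScale P.β P.α P.a P.b S.q ^ (-(k : ℝ))))
    (hJinv : ∀ k ≤ K + 2, Torus.eContDiffHolderNorm k 0 (fun x => (gradPhi 𝒟.D i t x)⁻¹) ≤
      ENNReal.ofReal (CJ * mollScale P.β P.α P.a P.b S.q ^ (-(k : ℝ))))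
    {x' : 𝕋³} (hη : 𝒟.cut.η i t x' ≠ 0)
    (hnl : 1 ≤ (P.freqNat (S.q + 1) : ℝ) * mollScale P.β P.α P.a P.b S.q)
    {U : ℝ} (hU0 : 0 ≤ U)
    (hU : ∀ c d, BoundFam K (𝔚.fluctZ c d) (Metric.closedBall (1 : 𝕄) mikadoRadius) U ∧
      ∀ a b, BoundFam K (dR (Matrix.single a b 1) (𝔚.fluctZ c d)) (Metric.closedBall (1 : 𝕄) mikadoRadius) U)
    {r : ℝ≥0} (hr1 : r ≤ 1) {Cd Cr : ℝ≥0}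
    (hCd : ∀ A : 𝕋³ → Fin 3 → ℝ³, IsSmooth A →
      Torus.eContDiffHolderNorm 0 r (Torus.antidivergence (Torus.tensorDivergence A)) ≤
        Cd * Torus.eContDiffHolderNorm 0 r A)
    (hCr : ∀ w : 𝕋³ → ℝ³, IsSmooth w →
      Torus.eContDiffHolderNorm 0 r (Torus.antidivergence w) ≤ Cr * Torus.eContDiffHolderNorm 0 r w) :
    Torus.eContDiffHolderNorm 0 r (Torus.antidivergence (Torus.tensorDivergence fun y j =>
        colsOf (principalOscMatrix P S 𝔚 𝒟.cut.η 𝒟.D i t y) j)) ≤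
      ENNReal.ofReal (810 * (leibConst (K + 1) ^ 4 * frameConst (K + 2) CJ Cin ^ 3 *
        (∑ k ∈ Finset.range (K + 3), |Cη 0 k|) ^ 2 * (amp P.β P.a P.b (S.q + 1) / c₀) *
        (mollScale P.β P.α P.a P.b S.q)⁻¹ * U *
        (aCoeff (K + 2) (frameConst (K + 2) CJ Cin) Cd K * (P.freqNat (S.q + 1) : ℝ) ^ (-1 + (r : ℝ)) +
          bCoeff (K + 2) (frameConst (K + 2) CJ Cin) Cr K * (P.freqNat (S.q + 1) : ℝ) ^ (r : ℝ) *
            (((P.freqNat (S.q + 1) : ℝ) * mollScale P.β P.α P.a P.b S.q)⁻¹) ^ K))) := by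
  -- notation
  set ℓ := mollScale P.β P.α P.a P.b S.q with hℓdef
  set n : ℕ := P.freqNat (S.q + 1) with hndef
  set Λ := frameConst (K + 2) CJ Cin with hΛdef
  set Cη' : ℝ := ∑ k ∈ Finset.range (K + 3), |Cη 0 k| with hCη'
  set c : ℝ := leibConst (K + 1) with hcdef
  set δ := amp P.β P.a P.b (S.q + 1) with hδdef
  set Rt : 𝕋³ → 𝕄 := fun x => tildeR P S 𝒟.cut.η 𝒟.D i t x with hRtdef
  have hℓ : 0 < ℓ := mollScale_pos ha _
  have hli0 : 0 ≤ ℓ⁻¹ := inv_nonneg.2 hℓ.le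
  have hδ : 0 < δ := amp_pos ha _
  have hc1 : 1 ≤ c := one_le_leibConst (K + 1)
  have hc0 : 0 ≤ c := zero_le_one.trans hc1
  have hCη'0 : 0 ≤ Cη' := Finset.sum_nonneg fun k _ => abs_nonneg _
  -- the frame at level `K + 2`
  have hP : PhaseFrame Rt (𝒟.D i t) n (K + 2) ℓ Λ (Metric.closedBall (1 : 𝕄) mikadoRadius) :=
    𝒟.phaseFrame H hCin ha hb hβ hα h4 hdef hstr hK hCJ ht hJ hJinv hη
  have hΛ1 : 1 ≤ Λ := hP.one_le_Λ
  have hΛ0 : 0 ≤ Λ := zero_le_one.trans hΛ1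
  have hΛJ : CJ ≤ Λ := (frameConst_bounds (K + 2) hCJ hCin).2.1
  have hρpos : ∀ s ∈ Icc 0 S.T, 0 < rhoQ P S s := fun s hs =>
    lt_of_lt_of_le (div_pos (mul_pos (amp_pos ha _) (Real.rpow_pos_of_pos (freq_pos ha _) _))
      (by norm_num)) (H.le_rhoQ h4 hs)
  have hDt : IsSmooth (𝒟.D i t) := hP.smooth_D
  -- `|∇Φ| ≤ Λ`
  have hJs : IsSmooth fun x => gradPhi 𝒟.D i t x := 𝒟.isSmooth_gradPhi H i ht
  have hJ' : ∀ x k m, |jac (𝒟.D i t) x k m| ≤ Λ := fun x k m =>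
    ((scaledBound_entry hJs hℓ hJ k m).abs_le hCJ x).trans hΛJ
  -- the conjugation amplitudes
  set F₀ : ℝ := c ^ 3 * Λ ^ 2 * Cη' ^ 2 * (δ / c₀) with hF₀def
  have hF₀ : 0 ≤ F₀ := by positivity
  have hAmpB : ∀ a' j c' d, ScaledBound (oscAmp P S 𝒟.cut.η 𝒟.D i t a' j c' d) (K + 2) ℓ F₀ :=
    fun a' j c' d => 𝒟.scaledBound_oscAmp H hc₀ ha hb hβ hα hρpos ht hP a' j c' d
  have hρs : IsSmooth (rhoI P S 𝒟.cut.η i t) := by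
    have hηs : IsSmooth (𝒟.cut.η i t) := (𝒟.cut.smooth i).isSmooth_slice ht
    exact (hηs.pow 2).mul (isSmooth_const _)
  have hA : ∀ m j, IsSmooth fun x => (jac (𝒟.D i t) x).adjugate m j := fun m j =>
    isSmooth_adjugate_jac_entry hDt m j
  have hAmps : ∀ a' j c' d, IsSmooth (oscAmp P S 𝒟.cut.η 𝒟.D i t a' j c' d) := fun a' j c' d =>
    (hρs.mul (hA a' c')).mul (hA j d)
  -- the two amplitude families of the slow divergence, at order `K + 1`
  set Fbig : ℝ := c * F₀ * Λ * ℓ⁻¹ with hFbigdef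
  have hFbig : 0 ≤ Fbig := by positivity
  have hf₁s : ∀ a' j c' d, IsSmooth (Torus.partialDeriv j (oscAmp P S 𝒟.cut.η 𝒟.D i t a' j c' d)) :=
    fun a' j c' d => (hAmps a' j c' d).partialDeriv j
  have hf₁B : ∀ a' j c' d, ScaledBound (Torus.partialDeriv j (oscAmp P S 𝒟.cut.η 𝒟.D i t a' j c' d))
      (K + 1) ℓ Fbig := by
    intro a' j c' d
    refine ((hAmpB a' j c' d).partialDeriv (hAmps a' j c' d) j).mono_M ?_ hℓ
    rw [hFbigdef]
    refine mul_le_mul_of_nonneg_right ?_ hli0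
    calc F₀ = 1 * F₀ * 1 := by ring
      _ ≤ c * F₀ * Λ := mul_le_mul (mul_le_mul_of_nonneg_right hc1 hF₀) hΛ1 zero_le_one (by positivity)
  have hRte : ∀ a b, IsSmooth fun x => Rt x a b := fun a b => isSmooth_entry hP.smooth_Rt a b
  have hRtd : ∀ j a b, IsSmooth fun x => Torus.partialDeriv j (fun y => Rt y a b) x := fun j a b =>
    (hRte a b).partialDeriv j
  have hRtdB : ∀ j a b, ScaledBound (Torus.partialDeriv j fun y => Rt y a b) (K + 1) ℓ (Λ * ℓ⁻¹) :=
    fun j a b => (hP.Rt_bound a b).partialDeriv (hRte a b) j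
  have hf₂s : ∀ a' j c' d a b, IsSmooth fun x => oscAmp P S 𝒟.cut.η 𝒟.D i t a' j c' d x *
      Torus.partialDeriv j (fun y => Rt y a b) x := fun a' j c' d a b => (hAmps a' j c' d).mul (hRtd j a b)
  have hl := leib_le (N := K + 1) (K₀ := K + 1) (by omega)
  push_cast at hl
  have hf₂B : ∀ a' j c' d a b, ScaledBound (fun x => oscAmp P S 𝒟.cut.η 𝒟.D i t a' j c' d x *
      Torus.partialDeriv j (fun y => Rt y a b) x) (K + 1) ℓ Fbig := by
    intro a' j c' d a b
    have h1 := ((hAmpB a' j c' d).mono_N (Nat.le_succ _)).mul (hRtdB j a b) (hAmps a' j c' d) (hRtd j a b)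
      hF₀ (by positivity) hℓ
    refine h1.mono_M ?_ hℓ
    push_cast
    calc (3 : ℝ) ^ (K + 1) * (K + 1 + 1) * F₀ * (Λ * ℓ⁻¹) ≤ c * F₀ * (Λ * ℓ⁻¹) :=
          mul_le_mul_of_nonneg_right (mul_le_mul_of_nonneg_right hl hF₀) (by positivity)
      _ = Fbig := by rw [hFbigdef]; ring
  -- the profiles: zero mean, joint smoothness
  have hG : ∀ c' d, JointSmooth (𝔚.fluctZ c' d) := fun c' d => 𝔚.jointSmooth_fluctZ c' d
  have hG0 : ∀ c' d (R : 𝕄), ∫ ξ, 𝔚.fluctZ c' d R ξ = 0 := fun c' d R => 𝔚.integral_fluctZ c' d R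
  have hGR : ∀ c' d a b, JointSmooth (dR (Matrix.single a b 1) (𝔚.fluctZ c' d)) := fun c' d a b =>
    (hG c' d).dR _
  have hGR0 : ∀ c' d a b (R : 𝕄), ∫ ξ, dR (Matrix.single a b 1) (𝔚.fluctZ c' d) R ξ = 0 :=
    fun c' d a b R => (hG c' d).integral_dR (hG0 c' d) _ R
  -- the level bound on each of the `81 + 729` terms of each component
  set q : ℝ := (((n : ℝ)) * ℓ)⁻¹ with hqdef
  set B : ℝ := Fbig * U * (aCoeff (K + 2) Λ Cd K * (n : ℝ) ^ (-1 + (r : ℝ)) +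
    bCoeff (K + 2) Λ Cr K * (n : ℝ) ^ (r : ℝ) * q ^ K) with hBdef
  have haK0 : 0 ≤ aCoeff (K + 2) Λ Cd K := aCoeff_nonneg (K + 2) hΛ0 (NNReal.coe_nonneg Cd) K
  have hbK0 : 0 ≤ bCoeff (K + 2) Λ Cr K := bCoeff_nonneg (K + 2) hΛ0 (NNReal.coe_nonneg Cr) K
  have hnr : (0 : ℝ) < n := Nat.cast_pos.2 (P.freqNat_pos ha _)
  have hq0 : 0 ≤ q := inv_nonneg.2 (mul_nonneg hnr.le hℓ.le)
  have hB0 : 0 ≤ B := by positivity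
  have hLB := hP.levelBoundR hnl hJ' hr1 hCd hCr
  have hnorm_e : ∀ a' : Fin 3, ‖EuclideanSpace.single a' (1 : ℝ)‖ = 1 := fun a' => by
    rw [EuclideanSpace.single, PiLp.norm_single, norm_one]
  -- the term functions
  set G₁ : Fin 3 → Fin 3 → Fin 3 → Fin 3 → 𝕋³ → ℝ³ := fun a' j c' d x =>
    (Torus.partialDeriv j (oscAmp P S 𝒟.cut.η 𝒟.D i t a' j c' d) x *
      phaseComp (𝔚.fluctZ c' d) Rt (𝒟.D i t) n x) • EuclideanSpace.single a' (1 : ℝ) with hG₁def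
  set G₂ : Fin 3 → Fin 3 → Fin 3 → Fin 3 → Fin 3 → Fin 3 → 𝕋³ → ℝ³ := fun a' j c' d a b x =>
    ((oscAmp P S 𝒟.cut.η 𝒟.D i t a' j c' d x * Torus.partialDeriv j (fun y => Rt y a b) x) *
      phaseComp (dR (Matrix.single a b 1) (𝔚.fluctZ c' d)) Rt (𝒟.D i t) n x) •
        EuclideanSpace.single a' (1 : ℝ) with hG₂def
  have hG₁s : ∀ a' j c' d, IsSmooth (G₁ a' j c' d) := fun a' j c' d =>
    ((hf₁s a' j c' d).mul ((hG c' d).phaseComp hP.smooth_Rt hDt n)).smul' (isSmooth_const _)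
  have hG₂s : ∀ a' j c' d a b, IsSmooth (G₂ a' j c' d a b) := fun a' j c' d a b =>
    ((hf₂s a' j c' d a b).mul ((hGR c' d a b).phaseComp hP.smooth_Rt hDt n)).smul' (isSmooth_const _)
  have hT₁ : ∀ a' j c' d, Torus.eContDiffHolderNorm 0 r (Torus.antidivergence (G₁ a' j c' d)) ≤
      ENNReal.ofReal B := by
    intro a' j c' d
    have h := hLB (EuclideanSpace.single a' (1 : ℝ)) K (by omega) _ _ Fbig U (hG c' d) (hG0 c' d)
      (hf₁s a' j c' d) hFbig (hf₁B a' j c' d) hU0 (hU c' d).1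
    rw [hnorm_e, one_mul] at h
    exact h
  have hT₂ : ∀ a' j c' d a b, Torus.eContDiffHolderNorm 0 r (Torus.antidivergence (G₂ a' j c' d a b)) ≤
      ENNReal.ofReal B := by
    intro a' j c' d a b
    have h := hLB (EuclideanSpace.single a' (1 : ℝ)) K (by omega) _ _ Fbig U (hGR c' d a b) (hGR0 c' d a b)
      (hf₂s a' j c' d a b) hFbig (hf₂B a' j c' d a b) hU0 ((hU c' d).2 a b)
    rw [hnorm_e, one_mul] at h
    exact h
  -- the slow-divergence identity, as `Pi` sums of the term functions
  have hdec : (Torus.tensorDivergence fun y j => colsOf (principalOscMatrix P S 𝔚 𝒟.cut.η 𝒟.D i t y) j) =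
      ∑ a', ∑ j, ∑ c', ∑ d, (G₁ a' j c' d + ∑ a, ∑ b, G₂ a' j c' d a b) := by
    funext x
    rw [𝒟.tensorDivergence_principalOscMatrix_eq H 𝔚 ha hc₀ hρpos ht hP.mem x]
    simp only [hG₁def, hG₂def, Finset.sum_apply, Pi.add_apply, oscSlowDiv, Finset.sum_smul, add_smul,
      hRtdef, hndef]
  rw [hdec]
  refine (holder_antidivergence_termSum_le hG₁s hG₂s hB0 hT₁ hT₂).trans (ENNReal.ofReal_le_ofReal (le_of_eq ?_))
  rw [hBdef, hFbigdef, hF₀def]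
  ring

end TermBound

section Discharge

variable {P : Params} {S : Setting} {Nbar : ℕ} {Cin C₀ c₀ : ℝ} {Cη : ℕ → ℕ → ℝ}

/-- **Discharge of `BDSV.oscillationPrincipalEstimate`** (BDSV §6.1.3, arXiv (6.11):
`‖𝒪₁‖_α ≲ Σ_iΣ_{k≠0}‖div(ρ_{q,i}∇Φ_i⁻¹C_k(R̃_{q,i})∇Φ_i⁻ᵀ)‖₀/λ_{q+1}^{1-α} + [large N] ≲ δ_{q+1}/(ℓλ_{q+1}^{1-α})
≲ δ_{q+1}^{1/2}δ_q^{1/2}λ_q/λ_{q+1}^{1-α}`), along the common prefix `BDSV.StageFact`: the threshold in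
`α` is `min(α₀(5.23), βb(b-1), (b-1)(1-β)/3, 1/2)`; `K = ⌈2b/((b-1)(1-β))⌉ + 1` integrations by
parts (so that `(2π)^K(ℓλ_{q+1})^{-K} ≤ λ_{q+1}^{-1}`, `BDSV.exists_threshold_phaseR`); `N̄ = max(N̄(5.23, K+2), K+2)`;
the thresholds in `a` of Lemma 5.4 (`4δ_{q+2} ≤ δ_{q+1}λ_q^{-α}`, deformation, stress), of `nℓ ≥ 1`
(arXiv (6.4)) and of the remainder; at each `t ∈ [0,T]` at most two cut-offs are active
(`BDSV.CutoffFamily.sum_abs_le_two_mul`), each bounded by `BDSV.PerturbationData.holder_antidivergence_principalOsc_le`,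
and the scale comparison is `BDSV.mainScale_le` / `BDSV.remainderScale_le`. The constant is
`2 · 810 · c⁴Λ³Cη'²c₀⁻¹ · U · (2π a_K + b_K)`.
[cite: BuckmasterEtAl2018, §6.1.3 (arXiv (6.11)) with Prop. 6.1 (6.1)] -/
theorem oscillationPrincipalEstimate_holds : oscillationPrincipalEstimate := by
  intro 𝔚 c₀ hc₀ Cη β hβ hβ' b hb hb'
  have hb0 : (0 : ℝ) < b := by linarith
  have hb1 : 0 < b - 1 := by linarith
  have h1β : 0 < 1 - β := by linarith
  have hβb : 0 < β * b * (b - 1) := by positivity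
  have hpos : 0 < (b - 1) * (1 - β) := mul_pos hb1 h1β
  obtain ⟨αJ, hαJ, hJall⟩ := gradPhiBound_allOrders c₀ hc₀ Cη β hβ hβ' b hb hb'
  refine ⟨min (min αJ (β * b * (b - 1))) (min ((b - 1) * (1 - β) / 3) (1 / 2)),
    lt_min (lt_min hαJ hβb) (lt_min (by positivity) one_half_pos), fun α hα hαlt => ?_⟩
  have hα₁ : α < αJ := lt_of_lt_of_le hαlt ((min_le_left _ _).trans (min_le_left _ _))
  have hα₂ : α < β * b * (b - 1) := lt_of_lt_of_le hαlt ((min_le_left _ _).trans (min_le_right _ _))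
  have hα₃ : α < (b - 1) * (1 - β) / 3 := lt_of_lt_of_le hαlt ((min_le_right _ _).trans (min_le_left _ _))
  have hα4 : α < 1 / 2 := lt_of_lt_of_le hαlt ((min_le_right _ _).trans (min_le_right _ _))
  have hα1 : α < 1 := by linarith
  have hαb : α < 2 * β * b * (b - 1) := by nlinarith
  have hαb' : 3 * α / 2 < (b - 1) * (1 - β) := by nlinarith
  -- the number of integrations by parts
  set K : ℕ := ⌈2 * b / ((b - 1) * (1 - β))⌉₊ + 1 with hKdef
  have hKineq : b < K * ((b - 1) * (1 - β) - 3 * α / 2) := by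
    have hD : (b - 1) * (1 - β) / 2 ≤ (b - 1) * (1 - β) - 3 * α / 2 := by nlinarith
    have hKge : 2 * b / ((b - 1) * (1 - β)) < K := by
      rw [hKdef]
      push_cast
      have := Nat.le_ceil (2 * b / ((b - 1) * (1 - β)))
      linarith
    have h1 : 2 * b < K * ((b - 1) * (1 - β)) := (div_lt_iff₀ hpos).1 hKge
    have hK0 : (0 : ℝ) ≤ K := Nat.cast_nonneg _
    nlinarith [mul_le_mul_of_nonneg_left hD hK0]
  obtain ⟨NJ, hNJ⟩ := hJall α hα hα₁ (K + 2)
  obtain ⟨U, hU0, hU⟩ := 𝔚.exists_boundFam_osc K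
  -- the Hölder exponent as an `ℝ≥0` and the two operator constants (Prop. C.1)
  set r : ℝ≥0 := ⟨α, hα.le⟩ with hr
  have hr0 : 0 < r := hα
  have hr1 : r < 1 := hα1
  have hrα : Real.toNNReal α = r := by
    rw [hr]; exact Real.toNNReal_of_nonneg hα.le
  have hrr : ((r : ℝ≥0) : ℝ) = α := rfl
  clear_value r
  obtain ⟨Cd, hCd⟩ := holder_antidivergence_tensorDivergence_le holderCZBound_holds hr0 hr1
  obtain ⟨Cr, hCr⟩ := holder_antidivergence_le holderCZBound_holds hr0 hr1
  refine ⟨max NJ (K + 2), fun Cin C₀ => ?_⟩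
  -- constants
  set Cin' : ℝ := max Cin 0 with hCin'def
  have hCp0 : 0 ≤ Cin' := le_max_right _ _
  obtain ⟨CJ, aJ, haJ, hCJall⟩ := hNJ Cin' C₀
  set CJ' : ℝ := max CJ 0 with hCJ'def
  have hCJ'0 : 0 ≤ CJ' := le_max_right _ _
  set Λ : ℝ := frameConst (K + 2) CJ' Cin' with hΛdef
  have hΛ1 : 1 ≤ Λ := (frameConst_bounds (K + 2) hCJ'0 hCp0).1
  have hΛ0 : 0 ≤ Λ := zero_le_one.trans hΛ1
  set Cη' : ℝ := ∑ k ∈ Finset.range (K + 3), |Cη 0 k| with hCη'def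
  set F₁ : ℝ := leibConst (K + 1) ^ 4 * Λ ^ 3 * Cη' ^ 2 * c₀⁻¹ with hF₁def
  have hF₁ : 0 ≤ F₁ := by positivity
  set aK : ℝ := aCoeff (K + 2) Λ Cd K with haK
  set bK : ℝ := bCoeff (K + 2) Λ Cr K with hbK
  have haK0 : 0 ≤ aK := aCoeff_nonneg _ hΛ0 (NNReal.coe_nonneg Cd) K
  have hbK0 : 0 ≤ bK := bCoeff_nonneg _ hΛ0 (NNReal.coe_nonneg Cr) K
  have hπ0 : (0 : ℝ) < 2 * Real.pi := by positivity
  -- thresholds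
  obtain ⟨a₁, ha₁, hpar₁⟩ := exists_threshold_four_amp hb hαb
  obtain ⟨a₂, ha₂, hpar₂⟩ := exists_threshold_deformation hβ.le hb.le hα hCp0 (b := b)
  obtain ⟨a₃, ha₃, hpar₃⟩ := exists_threshold_freq_mul_mollScale_rpow_le hβ.le hb.le hα (8 * Cin')
    (by norm_num : (0 : ℝ) < 1 / 100)
  obtain ⟨a₄, ha₄, hpar₄⟩ := exists_threshold_phaseR hb.le hKineq (β := β) (α := α)
  obtain ⟨a₅, ha₅, hpar₅⟩ := exists_threshold_mollScale_freq_succ hb.le hαb' (2 * Real.pi) (β := β)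
  refine ⟨2 * (810 * F₁ * U * (aK * (2 * Real.pi) + bK)), max (max (max a₁ a₂) (max a₃ a₄)) (max a₅ aJ),
    lt_max_of_lt_left (lt_max_of_lt_left (lt_max_of_lt_left ha₁)), fun a ha S H 𝒟 => ?_⟩
  have ha₁' : a₁ ≤ a := le_trans (le_max_left _ _) (le_trans (le_max_left _ _) (le_trans (le_max_left _ _) ha))
  have ha₂' : a₂ ≤ a := le_trans (le_max_right _ _) (le_trans (le_max_left _ _) (le_trans (le_max_left _ _) ha))
  have ha₃' : a₃ ≤ a := le_trans (le_max_left _ _) (le_trans (le_max_right _ _) (le_trans (le_max_left _ _) ha))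
  have ha₄' : a₄ ≤ a := le_trans (le_max_right _ _) (le_trans (le_max_right _ _) (le_trans (le_max_left _ _) ha))
  have ha₅' : a₅ ≤ a := le_trans (le_max_left _ _) (le_trans (le_max_right _ _) ha)
  have haJ' : aJ ≤ a := le_trans (le_max_right _ _) (le_trans (le_max_right _ _) ha)
  have ha1 : (1 : ℝ) ≤ a := ha₁.le.trans ha₁'
  -- the hypotheses with the nonnegative constant `Cin'`
  have H' : CoreHypotheses ⟨β, α, a, b⟩ S (max NJ (K + 2)) Cin' C₀ := H.mono_const ha1 (le_max_left _ _)
  have HJ : CoreHypotheses ⟨β, α, a, b⟩ S NJ Cin' C₀ := H'.of_le (le_max_left _ _)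
  have h4 := hpar₁ a ha₁' S.q
  have hdef := hpar₂ a ha₂' S.q
  have hstr : 8 * (Cin' * (freq a b S.q ^ α * mollScale β α a b S.q ^ α)) ≤ 1 / 100 := by
    have := hpar₃ a ha₃' S.q
    linarith
  have hrem := hpar₄ a ha₄' S.q
  -- scales
  set ℓ : ℝ := mollScale β α a b S.q with hℓdef
  set n : ℕ := Params.freqNat ⟨β, α, a, b⟩ (S.q + 1) with hndef
  set δ : ℝ := amp β a b (S.q + 1) with hδdef
  have hℓ : 0 < ℓ := mollScale_pos ha1 _
  have hδ : 0 < δ := amp_pos ha1 _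
  have hnr : (0 : ℝ) < n := Nat.cast_pos.2 (Params.freqNat_pos ⟨β, α, a, b⟩ ha1 _)
  have hfreq : freq a b (S.q + 1) = 2 * Real.pi * (n : ℝ) := Params.freq_eq ⟨β, α, a, b⟩ (by linarith) (S.q + 1)
  have hnl : 1 ≤ (n : ℝ) * ℓ := by
    have h := hpar₅ a ha₅' S.q
    rw [hfreq] at h
    have h' : 2 * Real.pi * 1 ≤ 2 * Real.pi * ((n : ℝ) * ℓ) := by
      calc 2 * Real.pi * 1 = 2 * Real.pi := mul_one _
        _ ≤ mollScale β α a b S.q * (2 * Real.pi * (n : ℝ)) := h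
        _ = 2 * Real.pi * ((n : ℝ) * ℓ) := by rw [hℓdef]; ring
    exact le_of_mul_le_mul_left h' hπ0
  have hρpos : ∀ s ∈ Icc 0 S.T, 0 < rhoQ ⟨β, α, a, b⟩ S s := fun s hs =>
    lt_of_lt_of_le (div_pos (mul_pos (amp_pos ha1 _) (Real.rpow_pos_of_pos (freq_pos ha1 _) _))
      (by norm_num)) (H'.le_rhoQ h4 hs)
  -- the common bound for one cut-off
  set Bq : ℝ := 810 * (leibConst (K + 1) ^ 4 * Λ ^ 3 * Cη' ^ 2 * (δ / c₀) * ℓ⁻¹) * U *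
    (aK * (n : ℝ) ^ (-1 + α) + bK * (n : ℝ) ^ α * ((((n : ℝ)) * ℓ)⁻¹) ^ K) with hBqdef
  have hq0 : 0 ≤ ((((n : ℝ)) * ℓ)⁻¹) ^ K := pow_nonneg (inv_nonneg.2 (mul_nonneg hnr.le hℓ.le)) K
  have hBq0 : 0 ≤ Bq := by positivity
  intro t ht
  have hterm : ∀ i, Torus.eContDiffHolderNorm 0 r (Torus.antidivergence (Torus.tensorDivergence fun y j =>
      colsOf (principalOscMatrix ⟨β, α, a, b⟩ S 𝔚 𝒟.cut.η 𝒟.D i t y) j)) ≤ ENNReal.ofReal Bq := by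
    intro i
    by_cases hact : ∃ x, 𝒟.cut.η i t x ≠ 0
    · obtain ⟨x', hx'⟩ := hact
      have hti : t ∈ tildeInterval S.T (Params.τ ⟨β, α, a, b⟩ S.q) i := 𝒟.cut.mem_tildeInterval ht hx'
      have hJK := fun k hk => hCJall a haJ' S HJ 𝒟 i k hk
      have hℓk : ∀ k : ℕ, 0 ≤ ℓ ^ (-(k : ℝ)) := fun k => Real.rpow_nonneg hℓ.le _
      have hJ : ∀ k ≤ K + 2, Torus.eContDiffHolderNorm k 0 (fun x => gradPhi 𝒟.D i t x) ≤
          ENNReal.ofReal (CJ' * ℓ ^ (-(k : ℝ))) := fun k hk =>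
        ((hJK k hk).1.mono (mul_le_mul_of_nonneg_right (le_max_left _ _) (hℓk k))) t hti
      have hJinv : ∀ k ≤ K + 2, Torus.eContDiffHolderNorm k 0 (fun x => (gradPhi 𝒟.D i t x)⁻¹) ≤
          ENNReal.ofReal (CJ' * ℓ ^ (-(k : ℝ))) := fun k hk =>
        ((hJK k hk).2.mono (mul_le_mul_of_nonneg_right (le_max_left _ _) (hℓk k))) t hti
      have h := 𝒟.holder_antidivergence_principalOsc_le H' 𝔚 hc₀ hCp0 ha1 hb.le hβ.le hα.le h4 hdef hstr
        (le_max_right _ _) hCJ'0 ht hJ hJinv hx' hnl hU0 hU hr1.le hCd hCr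
      rw [hrr] at h
      refine h.trans (ENNReal.ofReal_le_ofReal (le_of_eq ?_))
      rw [hBqdef]
      ring
    · simp only [not_exists, not_not] at hact
      rw [tensorDivergence_principalOscMatrix_eq_zero_of_eta 𝔚 𝒟.cut.η 𝒟.D hact,
        show (fun _ : 𝕋³ => (0 : ℝ³)) = 0 from rfl, Torus.antidivergence_zero, Torus.eContDiffHolderNorm_zero_fun]
      exact bot_le
  -- at most two cut-offs are active
  have hSi : ∀ i, IsSmooth (Torus.antidivergence (Torus.tensorDivergence fun y j =>
      colsOf (principalOscMatrix ⟨β, α, a, b⟩ S 𝔚 𝒟.cut.η 𝒟.D i t y) j)) := fun i =>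
    Torus.isSmooth_antidivergence (Torus.isSmooth_finset_sum Finset.univ fun l _ =>
      ((𝒟.isSmooth_principalOscCols H' 𝔚 hc₀ hρpos i ht).column l).partialDeriv l)
  have hfin : ∀ i, Torus.eContDiffHolderNorm 0 r (Torus.antidivergence (Torus.tensorDivergence fun y j =>
      colsOf (principalOscMatrix ⟨β, α, a, b⟩ S 𝔚 𝒟.cut.η 𝒟.D i t y) j)) ≠ ⊤ := fun i =>
    ((hSi i).eContDiffHolderNorm_lt_top 0 hr1.le).ne
  set g : ℕ → ℝ := fun i => (Torus.eContDiffHolderNorm 0 r (Torus.antidivergence (Torus.tensorDivergence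
    fun y j => colsOf (principalOscMatrix ⟨β, α, a, b⟩ S 𝔚 𝒟.cut.η 𝒟.D i t y) j))).toReal with hgdef
  have hg0 : ∀ i, 0 ≤ g i := fun i => ENNReal.toReal_nonneg
  have hgzero : ∀ i, (∀ x, 𝒟.cut.η i t x = 0) → g i = 0 := by
    intro i hi
    simp only [hgdef]
    rw [tensorDivergence_principalOscMatrix_eq_zero_of_eta 𝔚 𝒟.cut.η 𝒟.D hi,
      show (fun _ : 𝕋³ => (0 : ℝ³)) = 0 from rfl, Torus.antidivergence_zero, Torus.eContDiffHolderNorm_zero_fun,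
      ENNReal.toReal_zero]
  have hgB : ∀ i, |g i| ≤ Bq := fun i => by
    rw [abs_of_nonneg (hg0 i)]
    exact ENNReal.toReal_le_of_le_ofReal hBq0 (hterm i)
  have hτ : 0 < Params.τ ⟨β, α, a, b⟩ S.q := glueScale_pos ha1 _
  have hsum2 := 𝒟.cut.sum_abs_le_two_mul hτ hBq0 hgzero hgB (cutoffCount S.T (Params.τ ⟨β, α, a, b⟩ S.q))
  have hsum2' : ∑ i ∈ Finset.range (cutoffCount S.T (Params.τ ⟨β, α, a, b⟩ S.q)), g i ≤ 2 * Bq := by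
    refine le_trans (le_of_eq (Finset.sum_congr rfl fun i _ => (abs_of_nonneg (hg0 i)).symm)) hsum2
  -- assemble
  dsimp only
  rw [hrα]
  rw [𝒟.antidivergence_oscPrincipalSource_eq_sum H' 𝔚 ha1 hc₀ hρpos ht]
  calc Torus.eContDiffHolderNorm 0 r (∑ i ∈ Finset.range (cutoffCount S.T (Params.τ ⟨β, α, a, b⟩ S.q)),
        Torus.antidivergence (Torus.tensorDivergence fun y j =>
          colsOf (principalOscMatrix ⟨β, α, a, b⟩ S 𝔚 𝒟.cut.η 𝒟.D i t y) j))
      ≤ ∑ i ∈ Finset.range (cutoffCount S.T (Params.τ ⟨β, α, a, b⟩ S.q)),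
          Torus.eContDiffHolderNorm 0 r (Torus.antidivergence (Torus.tensorDivergence fun y j =>
            colsOf (principalOscMatrix ⟨β, α, a, b⟩ S 𝔚 𝒟.cut.η 𝒟.D i t y) j)) :=
        Torus.eContDiffHolderNorm_sum_le _ fun i _ => (hSi i).isContDiff (by simp)
    _ = ∑ i ∈ Finset.range (cutoffCount S.T (Params.τ ⟨β, α, a, b⟩ S.q)), ENNReal.ofReal (g i) :=
        Finset.sum_congr rfl fun i _ => (ENNReal.ofReal_toReal (hfin i)).symm
    _ = ENNReal.ofReal (∑ i ∈ Finset.range (cutoffCount S.T (Params.τ ⟨β, α, a, b⟩ S.q)), g i) :=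
        (ENNReal.ofReal_sum_of_nonneg fun i _ => hg0 i).symm
    _ ≤ ENNReal.ofReal (2 * Bq) := ENNReal.ofReal_le_ofReal hsum2'
    _ ≤ _ := ENNReal.ofReal_le_ofReal ?_
  -- the scale comparison
  have hmain := mainScale_le ⟨β, α, a, b⟩ ha1 hb.le hα.le S.q
  have hremS := remainderScale_le ⟨β, α, a, b⟩ ha1 hb.le hα.le S.q (K := K) hrem
  dsimp only at hmain hremS
  set Sc : ℝ := Real.sqrt (amp β a b (S.q + 1)) * Real.sqrt (amp β a b S.q) * freq a b S.q *
    freq a b (S.q + 1) ^ (-1 + 4 * α) with hScdef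
  have e1 : Bq = 810 * F₁ * U * (aK * (δ * ℓ⁻¹ * (n : ℝ) ^ (-1 + α)) +
      bK * (δ * ℓ⁻¹ * ((n : ℝ) ^ α * ((((n : ℝ)) * ℓ)⁻¹) ^ K))) := by
    rw [hBqdef, hF₁def, div_eq_mul_inv]
    ring
  rw [e1]
  have hX : 0 ≤ 810 * F₁ * U := mul_nonneg (mul_nonneg (by norm_num) hF₁) hU0
  have i1 : aK * (δ * ℓ⁻¹ * (n : ℝ) ^ (-1 + α)) ≤ aK * (2 * Real.pi * Sc) := mul_le_mul_of_nonneg_left hmain haK0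
  have i2 : bK * (δ * ℓ⁻¹ * ((n : ℝ) ^ α * ((((n : ℝ)) * ℓ)⁻¹) ^ K)) ≤ bK * Sc :=
    mul_le_mul_of_nonneg_left hremS hbK0
  calc 2 * (810 * F₁ * U * (aK * (δ * ℓ⁻¹ * (n : ℝ) ^ (-1 + α)) +
        bK * (δ * ℓ⁻¹ * ((n : ℝ) ^ α * ((((n : ℝ)) * ℓ)⁻¹) ^ K))))
      ≤ 2 * (810 * F₁ * U * (aK * (2 * Real.pi * Sc) + bK * Sc)) :=
        mul_le_mul_of_nonneg_left (mul_le_mul_of_nonneg_left (add_le_add i1 i2) hX) (by norm_num)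
    _ = 2 * (810 * F₁ * U * (aK * (2 * Real.pi) + bK)) * Sc := by ring

/-- **Discharge of the oscillation error `BDSV.oscillationErrorEstimate`** (arXiv (6.12): "Clearly,
(6.9) and (6.11) give (6.12)"): the proved assembly `BDSV.oscillationErrorEstimate_of_parts` applied
to `BDSV.oscillationPrincipalEstimate_holds` (this file) and `BDSV.oscillationCorrectorEstimate_holds`
(`OnsagerBDSVOscillationSplitProofs.lean`). [cite: BuckmasterEtAl2018, §6.1.3 (arXiv (6.12))] -/
theorem oscillationErrorEstimate_holds : oscillationErrorEstimate :=
  oscillationErrorEstimate_of_parts oscillationPrincipalEstimate_holds oscillationCorrectorEstimate_holds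

end Discharge

end DeRosa

end Literature.Analysis.FluidPDE
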